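import Mathlib
import Literature.NumberTheory.LFunctions.Zhang2022.Section10cEval1214Tools
import Literature.NumberTheory.LFunctions.Zhang2022.Section10Lemma102LogMean
import Literature.NumberTheory.LFunctions.Zhang2022.AppendixALemma83RelHolds
import Literature.NumberTheory.LFunctions.Zhang2022.Section8FrontEnd810
import Literature.NumberTheory.LFunctions.Zhang2022.TypedSection10Rel
import HarnessLib

/-!
# Zhang (2022) §10 p. 61: the middle range of `S_j(𝐚₁₂,𝐚₁₄)`, first line — DAG node Z22:§10.u056 (i),
# `Typed.Sec10C.Mid1214Eval c′` HOLDS (for `c′ ≥ 0`)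

Topic `Literature/NumberTheory/LFunctions/Zhang2022` (Landau–Siegel audit tree; verdict-neutral).
Y. Zhang, *Discrete mean estimates and the Landau–Siegel zero*, arXiv:2211.02515v1 (2022)
[Zhang2022LandauSiegel], §10 p. 61 (tex L3089): in the evaluation of `S_j(𝐚₁₂,𝐚₁₄)`,

> "the sum over `P^{0.496} ≤ dr < P^{0.498}` is equal to
> `(500L′(1,χ)²/log²P) Σ_{P^{0.496}≤n<P^{0.498}} |χ(n)|λ₀ⱼ(n)φ(n)⁻¹(ῑ₃𝔣_{j6}(P^{0.498}/n)/0.498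
> + ῑ₄𝔣_{j7}(P^{0.5}/n)/0.5)(−1 + 𝔶₁ⱼ(P^{0.004}n)) + o(α)`"

("By a result similar to Lemma 10.2 and the results in Section 8"), typed by L3-t8 as
`Typed.Sec10C.Mid1214Eval c′` — **an unrefereed manuscript under adjudication; this file proves one
displayed step from tree theorems and asserts nothing about Theorems 1–2 or about Landau–Siegel
zeros.** ZHANG-L discharge lane (WP10, seat zl-w10-p1; leaf `Typed.Sec10C.Gather1214`, input `hMidE`
of `gather1214_of_ranges`). Theorem-only: 0 definitions, 0 named facts.

* `mid1214Eval_of : Typed.Sec10Rel.LogMean0Rel c′ → Skeleton.Lemma82 c′ → Section8cStatements.Eq810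
  → Mid1214Eval c′` — the deduction made explicit: the `m`-sum at `n = dr` is Lemma 8.2's sum at
  `x = P₃/n` (`μ = 6`, main for `n < P₃/T`, crude on the top `T`-window) plus the one at `x = P₂/n`
  (`μ = 7`, always main) (`Sec10C.mSum12_eq`); the `n`-sum is the shifted `𝔳₂ⱼ`-sum
  (`Sec10C.nSum14_eq_frakv2S`), evaluated on `P^{0.5} < y* ≤ P^{0.502}/T` by the shifted (10.9) in
  relative form (`Lemma102.frakv2S_mid_of_key`) from the shift-0 log-mean estimate `LogMean0Rel`, and
  bounded crudely on the two windows `y* ≤ P^{0.5}`, `y* > P^{0.502}/T` through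
  `XiZeroMajorant.xiZeroTailMean` (`Sec10C.norm_frakv2S_le_of_logMean_le`); the `(d,r)`-sum is
  collapsed by (8.10) in L3-t4's relative assembly `Ranges1422.range_assembly_bound₃` (weights
  `Σ(n/φ(n))⁷/n`: `≪ 𝓛⁹` over the range, `≪ 𝓛^{1.1} + log(Dt₀)` over the windows); the printed
  `P^{0.5}`, `0.5 log P`, `𝔶₁ⱼ(P^{0.004}n)` replace `P₂`, `log P₂`, `𝔶₁ⱼ(y*)` at cost `O(𝓛^{1.1}α)`
  (`norm_frakfW7_P2_div_sub_le`, `norm_fraky1_yShift_sub_le`). Total error `≪_{c′} 𝓛^{−9.3+0.1·0}`: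
  precisely `≤ K·σ⁷𝓛⁻¹⁰` with `σ = 𝓛^{0.1}`, i.e. `≤ εα` once `𝓛^{0.3} ≥ K/(επ)`.
* `mid1214Eval_holds : 0 ≤ c′ → Mid1214Eval c′` — the three inputs are tree theorems:
  `Lemma102.logMeanRel_of_lemma83Rel (Skeleton.lemma83Rel_holds c′)` (zl-w10-p6, WP09),
  `Skeleton.lemma82_holds`, `Skeleton.eq810_holds`.

## References

* Y. Zhang, arXiv:2211.02515v1 (2022), §10 p. 61 (tex L3089), Lemma 10.2 p. 55, Remark p. 57,
  Lemma 8.2 p. 46, (8.10) p. 48, §8 p. 47. [cite: Zhang2022LandauSiegel, §10 p. 61]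
-/

noncomputable section

open Complex Real Finset ComplexConjugate

namespace Literature.NumberTheory.LFunctions.Zhang2022.Typed.Sec10C

open Literature.NumberTheory.LFunctions.Zhang2022.Skeleton
open Literature.NumberTheory.LFunctions.Zhang2022.Typed.Sec10B (yShift frakv2S)
open Literature.NumberTheory.LFunctions.Zhang2022.Section8cProofs (betaJ_eq_real_mul_I large_D)

section W10Mid1214Eval

variable (c' : ℝ) {D : ℕ} (χ : DirichletCharacter ℂ D)

/-! ## Range facts for `P^{0.496} ≤ n < P^{0.498}` -/

omit χ in
/-- For `𝓛 ≥ 5` and `P^{0.496} ≤ n < P^{0.498}`: the two arguments `x₃ = P₃/n`, `x₂ = P₂/n` of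
Lemma 8.2 and the argument `P^{0.004}n` of `𝔶₁ⱼ` satisfy the size conditions used below.
[cite: Zhang2022LandauSiegel, §10 p. 61] -/
theorem mid_xfacts (hL5 : 5 ≤ ell D) {n : ℕ} (hn1 : 1 ≤ n)
    (hlo : bigP D ^ (0.496 : ℝ) ≤ (n : ℝ)) (hhi : (n : ℝ) < bigP D ^ (0.498 : ℝ)) :
    (1 < Skeleton.P3 D / n ∧ Skeleton.P3 D / n < bigP D) ∧
      ((n : ℝ) < Skeleton.P3 D / bigT D → bigT D < Skeleton.P3 D / n) ∧
      (Skeleton.P3 D / bigT D ≤ (n : ℝ) → Real.log (Skeleton.P3 D / n) ≤ ell D ^ (1.1 : ℝ)) ∧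
      (bigT D < Skeleton.P2 D / n ∧ Skeleton.P2 D / n < bigP D) ∧
      (|Real.log (bigP D ^ (0.004 : ℝ) * n / bigP D ^ (0.5 : ℝ))| ≤ 0.004 * ell D ^ 9 ∧
        |Real.log (bigP D ^ (0.504 : ℝ) / (bigP D ^ (0.004 : ℝ) * n))| ≤ 0.004 * ell D ^ 9 ∧
        |Real.log (bigP D ^ (0.502 : ℝ) / (bigP D ^ (0.004 : ℝ) * n))| ≤ 0.004 * ell D ^ 9) ∧
      ((n : ℝ) ≤ bigP D ∧ (n : ℝ) < bigP D / bigT D ^ 2 ∧ (n : ℝ) < Skeleton.P1 D) := by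
  have hℓ0 : (0 : ℝ) < ell D := by linarith
  have hℓ1 : (1 : ℝ) ≤ ell D := by linarith
  have hℓ3 : (3 : ℝ) ≤ ell D := by linarith
  have hn0 : (0 : ℝ) < n := by exact_mod_cast hn1
  have hP0 : 0 < bigP D := Real.exp_pos _
  have hT0 : 0 < bigT D := Real.exp_pos _
  have hlogP : Real.log (bigP D) = ell D ^ 9 := by rw [bigP, Real.log_exp]
  have hlogT : Real.log (bigT D) = ell D ^ (1.1 : ℝ) := by rw [bigT, Real.log_exp]
  set τ : ℝ := ell D ^ (1.1 : ℝ) with hτ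
  have hτ0 : 0 < τ := Real.rpow_pos_of_pos hℓ0 _
  have hτ2 : τ ≤ ell D ^ 2 := (bigT_lt_rpow hL5).1
  have h7 : (78125 : ℝ) ≤ ell D ^ 7 := by
    calc (78125 : ℝ) = 5 ^ 7 := by norm_num
      _ ≤ ell D ^ 7 := pow_le_pow_left₀ (by norm_num) hL5 7
  have h9 : ell D ^ 9 = ell D ^ 2 * ell D ^ 7 := by ring
  have hτsmall : 11 * τ < 0.002 * ell D ^ 9 := by rw [h9]; nlinarith [pow_nonneg hℓ0.le 2]
  -- logs of the data
  have hlogn_lo : 0.496 * ell D ^ 9 ≤ Real.log n := by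
    rw [← Real.log_exp (0.496 * ell D ^ 9), ← bigP_rpow]
    exact Real.log_le_log (by rw [bigP_rpow]; exact Real.exp_pos _) hlo
  have hlogn_hi : Real.log n < 0.498 * ell D ^ 9 := by
    rw [← Real.log_exp (0.498 * ell D ^ 9), ← bigP_rpow]; exact Real.log_lt_log hn0 hhi
  have hlogn0 : 0 ≤ Real.log n := Real.log_nonneg (by exact_mod_cast hn1)
  have hP3pos : 0 < Skeleton.P3 D := Real.rpow_pos_of_pos hP0 _
  have hP2pos : 0 < Skeleton.P2 D := div_pos (Real.rpow_pos_of_pos hP0 _) (pow_pos hT0 10)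
  have hlogP3 : Real.log (Skeleton.P3 D) = 0.498 * ell D ^ 9 := by
    rw [Skeleton.P3, Real.log_rpow hP0, hlogP]
  have hlogP2 : Real.log (Skeleton.P2 D) = 0.5 * ell D ^ 9 - 10 * τ := by
    rw [Skeleton.P2, Real.log_div (Real.rpow_pos_of_pos hP0 _).ne' (pow_pos hT0 10).ne',
      Real.log_rpow hP0, Real.log_pow, hlogT, hlogP]; push_cast; ring
  have hlogx3 : Real.log (Skeleton.P3 D / n) = 0.498 * ell D ^ 9 - Real.log n := by
    rw [Real.log_div hP3pos.ne' hn0.ne', hlogP3]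
  have hlogx2 : Real.log (Skeleton.P2 D / n) = 0.5 * ell D ^ 9 - 10 * τ - Real.log n := by
    rw [Real.log_div hP2pos.ne' hn0.ne', hlogP2]
  have hx3pos : 0 < Skeleton.P3 D / n := div_pos hP3pos hn0
  have hx2pos : 0 < Skeleton.P2 D / n := div_pos hP2pos hn0
  refine ⟨⟨?_, ?_⟩, ?_, ?_, ⟨?_, ?_⟩, ⟨?_, ?_, ?_⟩, ⟨?_, ?_, ?_⟩⟩
  · rw [lt_div_iff₀ hn0, one_mul]; exact hhi
  · rw [← Real.exp_log hx3pos, bigP, Real.exp_lt_exp, hlogx3]; nlinarith [pow_nonneg hℓ0.le 9]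
  · intro h
    rw [lt_div_iff₀ hn0]; rw [lt_div_iff₀ hT0] at h; linarith [mul_comm (n : ℝ) (bigT D)]
  · intro h
    rw [hlogx3]
    rw [div_le_iff₀ hT0] at h
    have : Real.log (Skeleton.P3 D) ≤ Real.log ((n : ℝ) * bigT D) := Real.log_le_log hP3pos h
    rw [Real.log_mul hn0.ne' hT0.ne', hlogP3, hlogT] at this
    linarith
  · rw [← Real.exp_log hx2pos, bigT, Real.exp_lt_exp, hlogx2]; linarith
  · rw [← Real.exp_log hx2pos, bigP, Real.exp_lt_exp, hlogx2]; nlinarith [pow_nonneg hℓ0.le 9]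
  · have hy0 : 0 < bigP D ^ (0.004 : ℝ) * n := by positivity
    rw [Real.log_div hy0.ne' (Real.rpow_pos_of_pos hP0 _).ne', Real.log_mul (Real.rpow_pos_of_pos hP0 _).ne'
      hn0.ne', Real.log_rpow hP0, Real.log_rpow hP0, hlogP, abs_le]
    constructor <;> linarith
  · have hy0 : 0 < bigP D ^ (0.004 : ℝ) * n := by positivity
    rw [Real.log_div (Real.rpow_pos_of_pos hP0 _).ne' hy0.ne', Real.log_mul (Real.rpow_pos_of_pos hP0 _).ne'
      hn0.ne', Real.log_rpow hP0, Real.log_rpow hP0, hlogP, abs_le]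
    constructor <;> linarith
  · have hy0 : 0 < bigP D ^ (0.004 : ℝ) * n := by positivity
    rw [Real.log_div (Real.rpow_pos_of_pos hP0 _).ne' hy0.ne', Real.log_mul (Real.rpow_pos_of_pos hP0 _).ne'
      hn0.ne', Real.log_rpow hP0, Real.log_rpow hP0, hlogP, abs_le]
    constructor <;> linarith
  · have hP1 : 1 ≤ bigP D := by rw [bigP]; exact Real.one_le_exp (by positivity)
    have : bigP D ^ (0.498 : ℝ) ≤ bigP D := by
      calc bigP D ^ (0.498 : ℝ) ≤ bigP D ^ (1 : ℝ) := Real.rpow_le_rpow_of_exponent_le hP1 (by norm_num)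
        _ = bigP D := Real.rpow_one _
    linarith
  · obtain ⟨-, -, h3, h4, h5, -, -⟩ := Ranges1422.range_facts (D := D) hℓ3
    linarith
  · obtain ⟨-, -, h3, h4, -, -, -⟩ := Ranges1422.range_facts (D := D) hℓ3
    rw [Skeleton.P1]; linarith

/-! ## The final numeric step (abstract bookkeeping in `ℓ = 𝓛`, `σ = 𝓛^{0.1}`) -/

/-- `T₁`: the main-range product `W₁(B_M + e_M)e_N`. [folklore] -/
private theorem numeric_T1 {ℓ σ Wm BM eM eN k₁ k₃ k₄ k₅ : ℝ} (hℓ : 1 ≤ ℓ) (hσ1 : 1 ≤ σ)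
    (hσℓ : σ ≤ ℓ) (hk₁ : 0 ≤ k₁) (hk₃ : 0 ≤ k₃) (hk₄ : 0 ≤ k₄) (hk₅ : 0 ≤ k₅)
    (hBM0 : 0 ≤ BM) (heM0 : 0 ≤ eM) (heN0 : 0 ≤ eN)
    (hWm : Wm ≤ k₁ * ℓ ^ 9) (hBM : BM ≤ k₃ / ℓ ^ 7) (heM : eM ≤ k₄ * (ℓ * σ) / ℓ ^ 15)
    (heN : eN ≤ k₅ / ℓ ^ 15) :
    Wm * ((BM + eM) * eN) ≤ k₁ * (k₃ + k₄) * k₅ * (σ ^ 7 / ℓ ^ 10) := by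
  have hℓ0 : 0 < ℓ := by linarith
  have hσ0 : 0 < σ := by linarith
  have heM' : eM ≤ k₄ / ℓ ^ 7 := by
    refine heM.trans ?_
    rw [div_le_div_iff₀ (by positivity) (by positivity)]
    have : ℓ * σ * ℓ ^ 7 ≤ ℓ ^ 15 := by
      calc ℓ * σ * ℓ ^ 7 ≤ ℓ * ℓ * ℓ ^ 7 := by gcongr
        _ = ℓ ^ 9 := by ring
        _ ≤ ℓ ^ 15 := pow_le_pow_right₀ hℓ (by norm_num)
    nlinarith
  have hsum : BM + eM ≤ (k₃ + k₄) / ℓ ^ 7 := by rw [add_div]; exact add_le_add hBM heM'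
  calc Wm * ((BM + eM) * eN) ≤ (k₁ * ℓ ^ 9) * ((k₃ + k₄) / ℓ ^ 7 * (k₅ / ℓ ^ 15)) := by
        refine mul_le_mul hWm (mul_le_mul hsum heN heN0 (by positivity)) (by positivity) (by positivity)
    _ = k₁ * (k₃ + k₄) * k₅ * (1 / ℓ ^ 13) := by field_simp
    _ ≤ k₁ * (k₃ + k₄) * k₅ * (σ ^ 7 / ℓ ^ 10) := by
        refine mul_le_mul_of_nonneg_left ?_ (by positivity)
        rw [div_le_div_iff₀ (by positivity) (by positivity)]
        have hσ7 : 1 ≤ σ ^ 7 := one_le_pow₀ hσ1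
        have hℓ3 : ℓ ^ 10 ≤ ℓ ^ 13 := pow_le_pow_right₀ hℓ (by norm_num)
        nlinarith [pow_pos hℓ0 10]

/-- `T₂`: the main-range product `W₁·e_M·‖c₀‖·2`. [folklore] -/
private theorem numeric_T2 {ℓ σ Wm eM c0 k₁ k₄ k₆ : ℝ} (hℓ : 1 ≤ ℓ) (hσ1 : 1 ≤ σ)
    (hk₁ : 0 ≤ k₁) (hk₄ : 0 ≤ k₄) (hk₆ : 0 ≤ k₆) (heM0 : 0 ≤ eM) (hc00 : 0 ≤ c0)
    (hWm : Wm ≤ k₁ * ℓ ^ 9) (heM : eM ≤ k₄ * (ℓ * σ) / ℓ ^ 15) (hc0 : c0 ≤ k₆ / ℓ ^ 7) :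
    Wm * (eM * c0 * 2) ≤ 2 * k₁ * k₄ * k₆ * (σ ^ 7 / ℓ ^ 10) := by
  have hℓ0 : 0 < ℓ := by linarith
  have hσ0 : 0 < σ := by linarith
  calc Wm * (eM * c0 * 2) ≤ (k₁ * ℓ ^ 9) * (k₄ * (ℓ * σ) / ℓ ^ 15 * (k₆ / ℓ ^ 7) * 2) := by
        refine mul_le_mul hWm ?_ (by positivity) (by positivity)
        gcongr
    _ = 2 * k₁ * k₄ * k₆ * (σ / ℓ ^ 12) := by field_simp
    _ ≤ 2 * k₁ * k₄ * k₆ * (σ ^ 7 / ℓ ^ 10) := by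
        refine mul_le_mul_of_nonneg_left ?_ (by positivity)
        rw [div_le_div_iff₀ (by positivity) (by positivity)]
        have hσ6 : 1 ≤ σ ^ 6 := one_le_pow₀ hσ1
        have hℓ2 : ℓ ^ 10 ≤ ℓ ^ 12 := pow_le_pow_right₀ hℓ (by norm_num)
        have : σ * ℓ ^ 10 ≤ σ * ℓ ^ 12 := by gcongr
        calc σ * ℓ ^ 10 ≤ σ * ℓ ^ 12 := this
          _ ≤ σ * ℓ ^ 12 * σ ^ 6 := le_mul_of_one_le_right (by positivity) hσ6
          _ = σ ^ 7 * ℓ ^ 12 := by ring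

/-- `T₃`: the window product `W₂·B_W·e_W` — the critical one, `= k·σ⁷/ℓ¹⁰` exactly. [folklore] -/
private theorem numeric_T3 {ℓ σ Ww BW eW k₂ k₇ k₈ : ℝ} (hℓ : 1 ≤ ℓ) (hσ1 : 1 ≤ σ)
    (hk₂ : 0 ≤ k₂) (hk₇ : 0 ≤ k₇) (hBW0 : 0 ≤ BW) (heW0 : 0 ≤ eW)
    (hWw : Ww ≤ k₂ * (ℓ * σ)) (hBW : BW ≤ k₇ * (ℓ * σ) ^ 2 / ℓ ^ 9)
    (heW : eW ≤ k₈ * ℓ * (ℓ * σ) ^ 4 / ℓ ^ 9) :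
    Ww * (BW * eW) ≤ k₂ * k₇ * k₈ * (σ ^ 7 / ℓ ^ 10) := by
  have hℓ0 : 0 < ℓ := by linarith
  have hσ0 : 0 < σ := by linarith
  calc Ww * (BW * eW) ≤ (k₂ * (ℓ * σ)) * (k₇ * (ℓ * σ) ^ 2 / ℓ ^ 9 * (k₈ * ℓ * (ℓ * σ) ^ 4 / ℓ ^ 9)) :=
        mul_le_mul hWw (mul_le_mul hBW heW heW0 (by positivity)) (by positivity) (by positivity)
    _ = k₂ * k₇ * k₈ * (σ ^ 7 / ℓ ^ 10) := by field_simp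

/-- `T₄`: the window product `W₂·B_M·‖c₀‖·2`. [folklore] -/
private theorem numeric_T4 {ℓ σ Ww BM c0 k₂ k₃ k₆ : ℝ} (hℓ : 1 ≤ ℓ) (hσ1 : 1 ≤ σ)
    (hk₂ : 0 ≤ k₂) (hk₃ : 0 ≤ k₃) (hk₆ : 0 ≤ k₆) (hBM0 : 0 ≤ BM) (hc00 : 0 ≤ c0)
    (hWw : Ww ≤ k₂ * (ℓ * σ)) (hBM : BM ≤ k₃ / ℓ ^ 7) (hc0 : c0 ≤ k₆ / ℓ ^ 7) :
    Ww * (BM * c0 * 2) ≤ 2 * k₂ * k₃ * k₆ * (σ ^ 7 / ℓ ^ 10) := by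
  have hℓ0 : 0 < ℓ := by linarith
  have hσ0 : 0 < σ := by linarith
  calc Ww * (BM * c0 * 2) ≤ (k₂ * (ℓ * σ)) * (k₃ / ℓ ^ 7 * (k₆ / ℓ ^ 7) * 2) := by
        refine mul_le_mul hWw ?_ (by positivity) (by positivity)
        gcongr
    _ = 2 * k₂ * k₃ * k₆ * (σ / ℓ ^ 13) := by field_simp
    _ ≤ 2 * k₂ * k₃ * k₆ * (σ ^ 7 / ℓ ^ 10) := by
        refine mul_le_mul_of_nonneg_left ?_ (by positivity)
        rw [div_le_div_iff₀ (by positivity) (by positivity)]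
        have hσ6 : 1 ≤ σ ^ 6 := one_le_pow₀ hσ1
        have hℓ3 : ℓ ^ 10 ≤ ℓ ^ 13 := pow_le_pow_right₀ hℓ (by norm_num)
        calc σ * ℓ ^ 10 ≤ σ * ℓ ^ 13 := by gcongr
          _ ≤ σ * ℓ ^ 13 * σ ^ 6 := le_mul_of_one_le_right (by positivity) hσ6
          _ = σ ^ 7 * ℓ ^ 13 := by ring

/-- **The numeric endgame**: with `σ¹⁰ = ℓ` (`σ = 𝓛^{0.1}`, so `σ⁷/ℓ¹⁰ = 1/(σ³ℓ⁹)`) the four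
products of the assembly are `≤ K/(σ³ℓ⁹) ≤ επ/ℓ⁹` once `K/(επ) ≤ σ³`. [cite: Zhang2022LandauSiegel, §10 p. 61] -/
theorem mid_numeric {ℓ σ ε Wm Ww BM eM eN c0 BW eW k₁ k₂ k₃ k₄ k₅ k₆ k₇ k₈ : ℝ} (hℓ : 1 ≤ ℓ)
    (hσ1 : 1 ≤ σ) (hσ : σ ^ 10 = ℓ) (hε : 0 < ε)
    (hk₁ : 0 ≤ k₁) (hk₂ : 0 ≤ k₂) (hk₃ : 0 ≤ k₃) (hk₄ : 0 ≤ k₄) (hk₅ : 0 ≤ k₅) (hk₆ : 0 ≤ k₆)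
    (hk₇ : 0 ≤ k₇)
    (hBM0 : 0 ≤ BM) (heM0 : 0 ≤ eM) (heN0 : 0 ≤ eN) (hc00 : 0 ≤ c0)
    (hBW0 : 0 ≤ BW) (heW0 : 0 ≤ eW)
    (hWm : Wm ≤ k₁ * ℓ ^ 9) (hWw : Ww ≤ k₂ * (ℓ * σ)) (hBM : BM ≤ k₃ / ℓ ^ 7)
    (heM : eM ≤ k₄ * (ℓ * σ) / ℓ ^ 15) (heN : eN ≤ k₅ / ℓ ^ 15) (hc0 : c0 ≤ k₆ / ℓ ^ 7)
    (hBW : BW ≤ k₇ * (ℓ * σ) ^ 2 / ℓ ^ 9) (heW : eW ≤ k₈ * ℓ * (ℓ * σ) ^ 4 / ℓ ^ 9)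
    (hK : (k₁ * (k₃ + k₄) * k₅ + 2 * k₁ * k₄ * k₆ + k₂ * k₇ * k₈ + 2 * k₂ * k₃ * k₆) / (ε * π) ≤ σ ^ 3) :
    Wm * ((BM + eM) * eN + eM * c0 * 2) + Ww * (BW * eW + BM * c0 * 2) ≤ ε * (π / ℓ ^ 9) := by
  have hℓ0 : 0 < ℓ := by linarith
  have hσ0 : 0 < σ := by linarith
  have hσℓ : σ ≤ ℓ := by
    calc σ = σ ^ 1 := (pow_one σ).symm
      _ ≤ σ ^ 10 := pow_le_pow_right₀ hσ1 (by norm_num)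
      _ = ℓ := hσ
  have T1 := numeric_T1 hℓ hσ1 hσℓ hk₁ hk₃ hk₄ hk₅ hBM0 heM0 heN0 hWm hBM heM heN
  have T2 := numeric_T2 hℓ hσ1 hk₁ hk₄ hk₆ heM0 hc00 hWm heM hc0
  have T3 := numeric_T3 hℓ hσ1 hk₂ hk₇ hBW0 heW0 hWw hBW heW
  have T4 := numeric_T4 hℓ hσ1 hk₂ hk₃ hk₆ hBM0 hc00 hWw hBM hc0
  set K : ℝ := k₁ * (k₃ + k₄) * k₅ + 2 * k₁ * k₄ * k₆ + k₂ * k₇ * k₈ + 2 * k₂ * k₃ * k₆ with hKdef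
  set u : ℝ := σ ^ 7 / ℓ ^ 10 with hu
  have hu0 : 0 < u := by positivity
  have hKσ : K ≤ ε * π * σ ^ 3 := by
    have := hK; rwa [div_le_iff₀ (by positivity), mul_comm] at this
  calc Wm * ((BM + eM) * eN + eM * c0 * 2) + Ww * (BW * eW + BM * c0 * 2)
      = Wm * ((BM + eM) * eN) + Wm * (eM * c0 * 2) + (Ww * (BW * eW) + Ww * (BM * c0 * 2)) := by ring
    _ ≤ k₁ * (k₃ + k₄) * k₅ * u + 2 * k₁ * k₄ * k₆ * u + (k₂ * k₇ * k₈ * u + 2 * k₂ * k₃ * k₆ * u) := by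
        gcongr
    _ = K * u := by rw [hKdef]; ring
    _ ≤ (ε * π * σ ^ 3) * u := mul_le_mul_of_nonneg_right hKσ hu0.le
    _ = ε * (π / ℓ ^ 9) := by rw [hu, ← hσ]; field_simp

/-! ## Per-`n` algebra, abstract over the complex values -/

/-- `∏_{q∣n}(1 − q⁻¹)⁻¹ = n/φ(n)` (`n ≠ 0`; cf. `PlateauMollifier.prod_primeFactors_one_sub_inv_inv`). [folklore] -/
private theorem prod_primeFactors_eq (n : ℕ) (hn : n ≠ 0) :
    (∏ q ∈ n.primeFactors, (1 - (q : ℝ)⁻¹)⁻¹) ^ 2 = ((n : ℝ) / Nat.totient n) ^ 2 := by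
  congr 1
  rw [self_div_totient_eq_prod hn]
  refine Finset.prod_congr rfl fun q hq => ?_
  have h2 : (2 : ℝ) ≤ q := by exact_mod_cast (Nat.prime_of_mem_primeFactors hq).two_le
  have hq0 : (q : ℝ) ≠ 0 := by linarith
  have hq1 : (q : ℝ) - 1 ≠ 0 := by linarith
  field_simp

/-- `M − M₀` regrouped. [folklore] -/
private theorem M_sub_M0_eq (cι₃ cι₄ S6 S7 f6 f7 f7' Lp Λ₃ Λ₂ Λ₅ : ℂ) :
    (cι₃ * ((1 / Λ₃) * S6) + cι₄ * ((1 / Λ₂) * S7)) - Lp * (cι₃ * f6 / Λ₃ + cι₄ * f7' / Λ₅) =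
      cι₃ * ((S6 - Lp * f6) / Λ₃) + cι₄ * ((S7 - Lp * f7) / Λ₂ + Lp * (f7 / Λ₂ - f7' / Λ₅)) := by
  ring

/-- `‖M − M₀‖` from the sizes of its pieces. [folklore] -/
private theorem norm_M_sub_M0_le {cι₃ cι₄ S6 S7 f6 f7 f7' Lp Λ₃ Λ₂ Λ₅ : ℂ}
    {A3 A4 E6 E7 L3 L2 lp sh : ℝ} (h3 : ‖cι₃‖ ≤ A3) (h4 : ‖cι₄‖ ≤ A4) (e6 : ‖S6 - Lp * f6‖ ≤ E6)
    (e7 : ‖S7 - Lp * f7‖ ≤ E7) (hΛ₃ : ‖Λ₃‖ = L3) (hΛ₂ : L2 ≤ ‖Λ₂‖) (hL2 : 0 < L2) (hL3 : 0 < L3)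
    (hlp : ‖Lp‖ ≤ lp) (hsh : ‖f7 / Λ₂ - f7' / Λ₅‖ ≤ sh) :
    ‖(cι₃ * ((1 / Λ₃) * S6) + cι₄ * ((1 / Λ₂) * S7)) - Lp * (cι₃ * f6 / Λ₃ + cι₄ * f7' / Λ₅)‖ ≤
      A3 * (E6 / L3) + A4 * (E7 / L2 + lp * sh) := by
  have hE6 : 0 ≤ E6 := (norm_nonneg _).trans e6
  have hE7 : 0 ≤ E7 := (norm_nonneg _).trans e7
  have hsh0 : 0 ≤ sh := (norm_nonneg _).trans hsh
  have hlp0 : 0 ≤ lp := (norm_nonneg _).trans hlp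
  rw [M_sub_M0_eq]
  calc _ ≤ ‖cι₃ * ((S6 - Lp * f6) / Λ₃)‖ + ‖cι₄ * ((S7 - Lp * f7) / Λ₂ + Lp * (f7 / Λ₂ - f7' / Λ₅))‖ :=
        norm_add_le _ _
    _ ≤ A3 * (E6 / L3) + A4 * (E7 / L2 + lp * sh) := by
        refine add_le_add ?_ ?_
        · rw [norm_mul, norm_div, hΛ₃]
          exact mul_le_mul h3 (div_le_div_of_nonneg_right e6 hL3.le) (by positivity)
            ((norm_nonneg _).trans h3)
        · rw [norm_mul]
          refine mul_le_mul h4 ?_ (norm_nonneg _) ((norm_nonneg _).trans h4)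
          calc ‖(S7 - Lp * f7) / Λ₂ + Lp * (f7 / Λ₂ - f7' / Λ₅)‖
              ≤ ‖(S7 - Lp * f7) / Λ₂‖ + ‖Lp * (f7 / Λ₂ - f7' / Λ₅)‖ := norm_add_le _ _
            _ ≤ E7 / L2 + lp * sh := by
                rw [norm_div, norm_mul]
                exact add_le_add (div_le_div₀ hE7 e7 hL2 hΛ₂)
                  (mul_le_mul hlp hsh (norm_nonneg _) hlp0)

/-- The scalar bound `e_M`. [folklore] -/
private theorem eM_arith {ℓ σ b cL : ℝ} (hℓ : 1 ≤ ℓ) (hσ : 1 ≤ σ) (hb : 0 ≤ b) (hcL : 0 ≤ cL) :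
    1.25 * (b * (ℓ ^ 6)⁻¹ / (0.498 * ℓ ^ 9)) +
        2.3 * (b * (ℓ ^ 6)⁻¹ / (0.4 * ℓ ^ 9) + cL * ℓ ^ 2 * (5000 * (ℓ * σ) * (π / ℓ ^ 9) / ℓ ^ 9)) ≤
      (8.3 * b + 11500 * π * cL) * (ℓ * σ) / ℓ ^ 15 := by
  have hℓ0 : 0 < ℓ := by linarith
  have hσ0 : 0 < σ := by linarith
  have e : 1.25 * (b * (ℓ ^ 6)⁻¹ / (0.498 * ℓ ^ 9)) +
      2.3 * (b * (ℓ ^ 6)⁻¹ / (0.4 * ℓ ^ 9) + cL * ℓ ^ 2 * (5000 * (ℓ * σ) * (π / ℓ ^ 9) / ℓ ^ 9)) =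
      ((1.25 / 0.498 + 2.3 / 0.4) * b + 11500 * π * cL * σ) / ℓ ^ 15 := by
    field_simp; ring
  rw [e, div_le_div_iff_of_pos_right (by positivity)]
  have hq : (1.25 : ℝ) / 0.498 + 2.3 / 0.4 ≤ 8.3 := by norm_num
  have hℓσ : 1 ≤ ℓ * σ := one_le_mul_of_one_le_of_one_le hℓ hσ
  have h1 : (1.25 / 0.498 + 2.3 / 0.4) * b ≤ 8.3 * b * (ℓ * σ) := by
    have : b ≤ b * (ℓ * σ) := le_mul_of_one_le_right hb hℓσ
    nlinarith
  have h2 : 11500 * π * cL * σ ≤ 11500 * π * cL * (ℓ * σ) := by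
    have h0 : 0 ≤ 11500 * π * cL := by positivity
    have : σ ≤ ℓ * σ := le_mul_of_one_le_left hσ0.le hℓ
    exact mul_le_mul_of_nonneg_left this h0
  nlinarith

/-- `‖M₀‖` from the sizes of its pieces. [folklore] -/
private theorem norm_M0_le {cι₃ cι₄ f6 f7' Lp Λ₃ Λ₅ : ℂ} {A3 A4 F L3 L5 lp : ℝ}
    (h3 : ‖cι₃‖ ≤ A3) (h4 : ‖cι₄‖ ≤ A4) (hf6 : ‖f6‖ ≤ F) (hf7 : ‖f7'‖ ≤ F) (hΛ₃ : ‖Λ₃‖ = L3)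
    (hΛ₅ : ‖Λ₅‖ = L5) (hL3 : 0 < L3) (hL5 : 0 < L5) (hlp : ‖Lp‖ ≤ lp) :
    ‖Lp * (cι₃ * f6 / Λ₃ + cι₄ * f7' / Λ₅)‖ ≤ lp * (A3 * F / L3 + A4 * F / L5) := by
  have hA3 : 0 ≤ A3 := (norm_nonneg _).trans h3
  have hA4 : 0 ≤ A4 := (norm_nonneg _).trans h4
  rw [norm_mul]
  refine mul_le_mul hlp ((norm_add_le _ _).trans (add_le_add ?_ ?_)) (norm_nonneg _)
    ((norm_nonneg _).trans hlp)
  · rw [norm_div, norm_mul, hΛ₃]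
    exact div_le_div_of_nonneg_right (mul_le_mul h3 hf6 (norm_nonneg _) hA3) hL3.le
  · rw [norm_div, norm_mul, hΛ₅]
    exact div_le_div_of_nonneg_right (mul_le_mul h4 hf7 (norm_nonneg _) hA4) hL5.le

/-- The scalar bound `B_M`. [folklore] -/
private theorem BM_arith {ℓ cL : ℝ} (hℓ : 0 < ℓ) (hcL : 0 ≤ cL) :
    cL * ℓ ^ 2 * (1.25 * 29 / (0.498 * ℓ ^ 9) + 2.3 * 29 / (0.5 * ℓ ^ 9)) ≤ 207 * cL / ℓ ^ 7 := by
  rw [show cL * ℓ ^ 2 * (1.25 * 29 / (0.498 * ℓ ^ 9) + 2.3 * 29 / (0.5 * ℓ ^ 9)) =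
    (1.25 * 29 / 0.498 + 2.3 * 29 / 0.5) * cL / ℓ ^ 7 by field_simp]
  rw [div_le_div_iff_of_pos_right (by positivity)]
  have : (1.25 : ℝ) * 29 / 0.498 + 2.3 * 29 / 0.5 ≤ 207 := by norm_num
  nlinarith

/-- `‖M‖` crude from the sizes of its pieces. [folklore] -/
private theorem norm_M_le {cι₃ cι₄ S6 S7 Λ₃ Λ₂ : ℂ} {A3 A4 B6 B7 L3 L2 : ℝ}
    (h3 : ‖cι₃‖ ≤ A3) (h4 : ‖cι₄‖ ≤ A4) (h6 : ‖S6‖ ≤ B6) (h7 : ‖S7‖ ≤ B7) (hΛ₃ : ‖Λ₃‖ = L3)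
    (hΛ₂ : L2 ≤ ‖Λ₂‖) (hL2 : 0 < L2) (hL3 : 0 < L3) :
    ‖cι₃ * ((1 / Λ₃) * S6) + cι₄ * ((1 / Λ₂) * S7)‖ ≤ A3 * (B6 / L3) + A4 * (B7 / L2) := by
  have hB7 : 0 ≤ B7 := (norm_nonneg _).trans h7
  calc _ ≤ ‖cι₃ * ((1 / Λ₃) * S6)‖ + ‖cι₄ * ((1 / Λ₂) * S7)‖ := norm_add_le _ _
    _ ≤ A3 * (B6 / L3) + A4 * (B7 / L2) := by
        refine add_le_add ?_ ?_
        · rw [norm_mul, norm_mul, norm_div, norm_one, hΛ₃, one_div, ← div_eq_inv_mul]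
          exact mul_le_mul h3 (div_le_div_of_nonneg_right h6 hL3.le) (by positivity)
            ((norm_nonneg _).trans h3)
        · rw [norm_mul, norm_mul, norm_div, norm_one, one_div, ← div_eq_inv_mul]
          refine mul_le_mul h4 ?_ (by positivity) ((norm_nonneg _).trans h4)
          exact div_le_div₀ hB7 h7 hL2 hΛ₂

/-- The scalar bound `B_W`. [folklore] -/
private theorem BW_arith {ℓ τ b cL : ℝ} (hℓ : 1 ≤ ℓ) (hτℓ : ℓ ≤ τ) (hb : 0 ≤ b) (hcL : 0 ≤ cL) :
    1.25 * ((29 * (cL * ℓ ^ 2) + b + 2 * τ ^ 2) / (0.498 * ℓ ^ 9)) +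
        2.3 * ((29 * (cL * ℓ ^ 2) + b) / (0.4 * ℓ ^ 9)) ≤ (240 * cL + 9 * b + 6) * τ ^ 2 / ℓ ^ 9 := by
  have hℓ0 : 0 < ℓ := by linarith
  have hτ1 : 1 ≤ τ := hℓ.trans hτℓ
  have hτsq : ℓ ^ 2 ≤ τ ^ 2 := pow_le_pow_left₀ hℓ0.le hτℓ 2
  have hτsq1 : 1 ≤ τ ^ 2 := one_le_pow₀ hτ1
  rw [show 1.25 * ((29 * (cL * ℓ ^ 2) + b + 2 * τ ^ 2) / (0.498 * ℓ ^ 9)) +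
      2.3 * ((29 * (cL * ℓ ^ 2) + b) / (0.4 * ℓ ^ 9)) =
      ((1.25 / 0.498) * (29 * (cL * ℓ ^ 2) + b + 2 * τ ^ 2) + 5.75 * (29 * (cL * ℓ ^ 2) + b)) / ℓ ^ 9 by
    field_simp; ring]
  rw [div_le_div_iff_of_pos_right (by positivity)]
  have hq : (1.25 : ℝ) / 0.498 ≤ 2.52 := by norm_num
  have h0 : 0 ≤ 29 * (cL * ℓ ^ 2) + b + 2 * τ ^ 2 := by positivity
  calc (1.25 / 0.498) * (29 * (cL * ℓ ^ 2) + b + 2 * τ ^ 2) + 5.75 * (29 * (cL * ℓ ^ 2) + b)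
      ≤ 2.52 * (29 * (cL * ℓ ^ 2) + b + 2 * τ ^ 2) + 5.75 * (29 * (cL * ℓ ^ 2) + b) := by gcongr
    _ = 239.83 * cL * ℓ ^ 2 + 8.27 * b + 5.04 * τ ^ 2 := by ring
    _ ≤ 239.83 * cL * τ ^ 2 + 8.27 * b * τ ^ 2 + 5.04 * τ ^ 2 := by
        have h1 : 239.83 * cL * ℓ ^ 2 ≤ 239.83 * cL * τ ^ 2 := mul_le_mul_of_nonneg_left hτsq (by positivity)
        have h2 : 8.27 * b ≤ 8.27 * b * τ ^ 2 := le_mul_of_one_le_right (by positivity) hτsq1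
        linarith
    _ ≤ (240 * cL + 9 * b + 6) * τ ^ 2 := by nlinarith

/-- Main-plus-error triangle bound. [folklore] -/
private theorem norm_le_of_sub_le {S m : ℂ} {E B : ℝ} (h : ‖S - m‖ ≤ E) (hm : ‖m‖ ≤ B) : ‖S‖ ≤ B + E := by
  calc ‖S‖ ≤ ‖S - m‖ + ‖m‖ := norm_le_norm_sub_add _ _
    _ ≤ E + B := add_le_add h hm
    _ = B + E := add_comm _ _

/-- `N − c₀ΠG` regrouped through the shifted argument. [folklore] -/
private theorem N_sub_eq (N Lp Pi y1 y2 Λ : ℂ) :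
    N - 500 * Lp / Λ * Pi * (-1 + y2) =
      (N - 500 * Lp * Pi / Λ * (-1 + y1)) + 500 * Lp / Λ * Pi * (y1 - y2) := by ring

/-- The scalar bound `e_N`. [folklore] -/
private theorem eN_arith {ℓ C cL w : ℝ} (hℓ : 0 < ℓ) (hw : 0 ≤ w) :
    1500 * (C * (ℓ ^ 6)⁻¹ * w) / ℓ ^ 9 + 500 * cL / ℓ ^ 7 * w * (7100 * (π / ℓ ^ 9) * ℓ) ≤
      (1500 * |C| + 3550000 * π * cL) / ℓ ^ 15 * w := by
  rw [show 1500 * (C * (ℓ ^ 6)⁻¹ * w) / ℓ ^ 9 + 500 * cL / ℓ ^ 7 * w * (7100 * (π / ℓ ^ 9) * ℓ) =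
      (1500 * C + 3550000 * π * cL) / ℓ ^ 15 * w by field_simp; ring]
  refine mul_le_mul_of_nonneg_right (div_le_div_of_nonneg_right ?_ (by positivity)) hw
  linarith [le_abs_self C]

/-- The scalar bound on the windows: the crude log-mean bound below `T`. [folklore] -/
private theorem window_crude_arith {ℓ τ L cξ w : ℝ} (hℓ : 0 < ℓ) (hτ1 : 1 ≤ τ) (hL0 : 0 ≤ L)
    (hLτ : L ≤ τ) (hw : 1 ≤ w) {cξ' : ℝ} (hcξ : cξ' ≤ cξ) (hS : 0 ≤ cξ' * ℓ * (1 + L) ^ 3) :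
    L * (cξ' * ℓ * (1 + L) ^ 3) ≤ 16 * cξ * ℓ * τ ^ 4 * w := by
  have hτ0 : 0 < τ := by linarith
  have h1 : L * (cξ' * ℓ * (1 + L) ^ 3) ≤ τ * (cξ * ℓ * (1 + τ) ^ 3) := by
    have : cξ' * ℓ * (1 + L) ^ 3 ≤ cξ * ℓ * (1 + τ) ^ 3 := by
      have hcξ0 : 0 ≤ cξ := by
        by_contra h
        have : cξ' < 0 := lt_of_le_of_lt hcξ (not_le.mp h)
        have h3 : 0 < ℓ * (1 + L) ^ 3 := by positivity
        nlinarith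
      calc cξ' * ℓ * (1 + L) ^ 3 ≤ cξ * ℓ * (1 + L) ^ 3 := by gcongr
        _ ≤ cξ * ℓ * (1 + τ) ^ 3 := by gcongr
    exact mul_le_mul hLτ this hS hτ0.le
  have h2 : (1 + τ) ^ 3 ≤ (2 * τ) ^ 3 := pow_le_pow_left₀ (by positivity) (by linarith) 3
  have hcξ0 : 0 ≤ cξ * ℓ := by
    have : 0 ≤ cξ := by
      by_contra h
      have : cξ' < 0 := lt_of_le_of_lt hcξ (not_le.mp h)
      have h3 : 0 < ℓ * (1 + L) ^ 3 := by positivity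
      nlinarith
    positivity
  calc L * (cξ' * ℓ * (1 + L) ^ 3) ≤ τ * (cξ * ℓ * (1 + τ) ^ 3) := h1
    _ ≤ τ * (cξ * ℓ * (2 * τ) ^ 3) := by gcongr
    _ = 8 * cξ * ℓ * τ ^ 4 := by ring
    _ ≤ 16 * cξ * ℓ * τ ^ 4 * w := by nlinarith [mul_nonneg hcξ0 (pow_nonneg hτ0.le 4)]

/-- The scalar bound on the windows: the main term plus error above `T`. [folklore] -/
private theorem window_main_arith {ℓ C cL lp w : ℝ} (hℓ : 1 ≤ ℓ) (hw : 0 ≤ w) (hlp0 : 0 ≤ lp)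
    (hlp : lp ≤ cL * ℓ ^ 2) :
    C * (ℓ ^ 6)⁻¹ * w + lp * w * (1 + 12 * π + 18 * π ^ 2) ≤ (220 * (cL * ℓ ^ 2) + |C|) * w := by
  have hℓ6 : (ℓ ^ 6)⁻¹ ≤ 1 := inv_le_one_of_one_le₀ (one_le_pow₀ hℓ)
  have hπ : 1 + 12 * π + 18 * π ^ 2 ≤ 220 := by nlinarith [Real.pi_lt_d2, Real.pi_pos]
  have t1 : C * (ℓ ^ 6)⁻¹ * w ≤ |C| * w := by
    refine mul_le_mul_of_nonneg_right ?_ hw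
    calc C * (ℓ ^ 6)⁻¹ ≤ |C| * (ℓ ^ 6)⁻¹ := by gcongr; exact le_abs_self C
      _ ≤ |C| * 1 := by gcongr
      _ = |C| := mul_one _
  have t2 : lp * w * (1 + 12 * π + 18 * π ^ 2) ≤ 220 * (cL * ℓ ^ 2) * w := by
    have : 0 ≤ lp * w := mul_nonneg hlp0 hw
    calc lp * w * (1 + 12 * π + 18 * π ^ 2) ≤ lp * w * 220 := by gcongr
      _ ≤ cL * ℓ ^ 2 * w * 220 := by gcongr
      _ = 220 * (cL * ℓ ^ 2) * w := by ring
  linarith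

/-- The scalar bound `e_W`. [folklore] -/
private theorem eW_arith {ℓ τ a cL cξ w : ℝ} (hℓ : 1 ≤ ℓ) (hτℓ : ℓ ≤ τ) (ha : 0 ≤ a) (hcL : 0 ≤ cL)
    (hcξ : 0 ≤ cξ) (hw : 0 ≤ w) :
    500 / ℓ ^ 9 * (4 * ((220 * (cL * ℓ ^ 2) + a + 16 * cξ * ℓ * τ ^ 4) * w)) ≤
      2000 * (220 * cL + a + 16 * cξ) * ℓ * τ ^ 4 / ℓ ^ 9 * w := by
  have hℓ0 : 0 < ℓ := by linarith
  have hτ1 : 1 ≤ τ := hℓ.trans hτℓ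
  rw [show 500 / ℓ ^ 9 * (4 * ((220 * (cL * ℓ ^ 2) + a + 16 * cξ * ℓ * τ ^ 4) * w)) =
      2000 * (220 * (cL * ℓ ^ 2) + a + 16 * cξ * ℓ * τ ^ 4) / ℓ ^ 9 * w by ring]
  refine mul_le_mul_of_nonneg_right (div_le_div_of_nonneg_right ?_ (by positivity)) hw
  have hτ4 : 1 ≤ τ ^ 4 := one_le_pow₀ hτ1
  have hℓτ' : ℓ ≤ τ ^ 4 := by
    calc ℓ ≤ τ := hτℓ
      _ = τ ^ 1 := (pow_one τ).symm
      _ ≤ τ ^ 4 := pow_le_pow_right₀ hτ1 (by norm_num)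
  have hℓτ : ℓ ^ 2 ≤ ℓ * τ ^ 4 := by nlinarith
  have h1 : 1 ≤ ℓ * τ ^ 4 := one_le_mul_of_one_le_of_one_le hℓ hτ4
  have e1 : 220 * (cL * ℓ ^ 2) ≤ 220 * cL * (ℓ * τ ^ 4) := by nlinarith
  have e2 : a ≤ a * (ℓ * τ ^ 4) := le_mul_of_one_le_right ha h1
  have e3 : 0 ≤ 16 * cξ * ℓ * τ ^ 4 := by
    have : 0 ≤ ℓ * τ ^ 4 := by positivity
    nlinarith [hcξ]
  nlinarith

/-! ## Re-indexing `S1214On` by `n = dr` -/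

/-- **Re-indexing `S1214On` by `n = dr`.** For a range `[lo, hi)` with `hi ≤ P^{0.504}` (`hi < ⌈PT⁻²⌉`):
`S1214On(j; lo, hi) = Σ_{lo ≤ n < hi} Σ_{r ∣ n, r squarefree} a(n)φ(r)⁻¹ · mSum12(n/r, r) · nSum14(n/r, r)`,
`a(n) = |χ(n)|λ₀ⱼ(n)/n`. [cite: Zhang2022LandauSiegel, §10 pp. 60–61] -/
theorem S1214On_eq_divisor_sum [NeZero D] (j : ℕ) {lo hi : ℝ}
    (hhi : ∀ n : ℕ, (n : ℝ) < hi → n < Nsupp D) :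
    S1214On c' χ j lo hi =
      ∑ n ∈ (Finset.Ico 1 (Nsupp D)).filter (fun n : ℕ => lo ≤ (n : ℝ) ∧ (n : ℝ) < hi),
        ∑ r ∈ n.divisors,
          (if Squarefree r then
            (‖χ (n : ZMod D)‖ : ℂ) * lamZero c' D j n / (n : ℂ) / (Nat.totient r : ℂ) *
              Sec10C.mSum12 c' χ j (n / r) r * Sec10C.nSum14 c' χ j (n / r) r else 0) := by
  classical
  unfold S1214On
  rw [Finset.sum_comm]
  rw [sum_box_ite_eq_sum_divisors (Nsupp D) (fun n : ℕ => lo ≤ (n : ℝ) ∧ (n : ℝ) < hi)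
    (fun n hn => hhi n hn.2) (fun d r => term1214 c' χ j d r)]
  refine Finset.sum_congr rfl fun n hn => Finset.sum_congr rfl fun r hr => ?_
  have hn0 : n ≠ 0 := by
    have := (Finset.mem_Ico.mp (Finset.mem_filter.mp hn).1).1; omega
  have hrd : r ∣ n := Nat.dvd_of_mem_divisors hr
  have hr0 : r ≠ 0 := Nat.pos_iff_ne_zero.mp (Nat.pos_of_mem_divisors hr)
  have hdr : n / r * r = n := Nat.div_mul_cancel hrd
  unfold term1214
  rw [norm_chi_mul_norm_moebius_chi χ (n / r) r]
  split_ifs with hsq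
  · rw [hdr]
    have hnC : (n : ℂ) ≠ 0 := by exact_mod_cast hn0
    have hφ : (Nat.totient r : ℂ) ≠ 0 := by
      exact_mod_cast (Nat.totient_pos.mpr (Nat.pos_of_ne_zero hr0)).ne'
    field_simp
  · simp

/-! ## The main theorem -/

/-- The filtered index set of the middle range of `S_j(𝐚₁₂,𝐚₁₄)` consists of `n ≥ 1` with
`P^{0.496} ≤ n < P^{0.498}`. [cite: Zhang2022LandauSiegel, §10 p. 61] -/
private theorem mem_midSet {D : ℕ} {n : ℕ}
    (hn : n ∈ (Finset.Ico 1 (Nsupp D)).filter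
      (fun n : ℕ => bigP D ^ (0.496 : ℝ) ≤ (n : ℝ) ∧ (n : ℝ) < bigP D ^ (0.498 : ℝ))) :
    1 ≤ n ∧ bigP D ^ (0.496 : ℝ) ≤ (n : ℝ) ∧ (n : ℝ) < bigP D ^ (0.498 : ℝ) := by
  rw [Finset.mem_filter, Finset.mem_Ico] at hn
  exact ⟨hn.1.1, hn.2.1, hn.2.2⟩

/-- Threshold: `D ≥ ⌈exp X⌉` gives `𝓛 ≥ X`. [folklore] -/
private theorem ell_ge_of_ceil_exp_le {X : ℝ} {D : ℕ} (hD : ⌈Real.exp X⌉₊ ≤ D) : X ≤ ell D := by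
  have h : Real.exp X ≤ D := le_trans (Nat.le_ceil _) (by exact_mod_cast hD)
  rw [ell]; exact (Real.le_log_iff_exp_le (lt_of_lt_of_le (Real.exp_pos _) h)).mpr h

/-! ## The per-`n` estimates of the middle range -/

section PerN

variable [NeZero D]

/-- **M-side, main `n`**: for `𝓛 ≥ 5`, `5|c′|α𝓛 ≤ 1`, `χ` primitive, Lemma 8.2 in force at the
modulus `D` with constant `C₂`, and `P^{0.496} ≤ n < P^{0.498}` with `n < P₃/T`: the `m`-sum at `n`
(`mSum12 c′ χ j n 1`) differs from the printed main term
`L′(ῑ₃𝔣_{j6}(P^{0.498}/n)/(0.498 log P) + ῑ₄𝔣_{j7}(P^{0.5}/n)/(0.5 log P))` by at most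
`(8.3|C₂| + 11500π·4e^{9/2})𝓛^{1.1}/𝓛¹⁵`. [cite: Zhang2022LandauSiegel, §10 p. 61] -/
theorem mid_M_main_le (hL5 : 5 ≤ ell D) (hc5 : 5 * |c'| * alpha D * ell D ≤ 1) (hp : χ.IsPrimitive)
    (j : ℕ) {C₂ : ℝ}
    (H₂ : ∀ μ ∈ ({6, 7} : Finset ℕ), ∀ y : ℝ, bigT D < y → y < bigP D →
      ‖(∑ m ∈ Finset.Ico 1 ⌈y⌉₊, χ (m : ZMod D) / (m : ℂ) ^ (1 - betaJ c' D j) *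
            ((y / m : ℝ) : ℂ) ^ betaMu D μ * (Real.log (y / m) : ℂ)) -
          deriv χ.LFunction 1 * frakfW c' D j μ y‖ ≤ C₂ * (ell D ^ 6)⁻¹)
    {n : ℕ} (hn1 : 1 ≤ n) (hlo : bigP D ^ (0.496 : ℝ) ≤ (n : ℝ)) (hhi : (n : ℝ) < bigP D ^ (0.498 : ℝ))
    (hmain : (n : ℝ) < Skeleton.P3 D / bigT D) :
    ‖Sec10C.mSum12 c' χ j n 1 - deriv χ.LFunction 1 *
        (conj iota3 * frakfW c' D j 6 (bigP D ^ (0.498 : ℝ) / n) / ((0.498 * Real.log (bigP D) : ℝ) : ℂ) +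
          conj iota4 * frakfW c' D j 7 (bigP D ^ (0.5 : ℝ) / n) / ((0.5 * Real.log (bigP D) : ℝ) : ℂ))‖ ≤
      (8.3 * |C₂| + 11500 * π * (4 * Real.exp (9 / 2))) * ell D ^ (1.1 : ℝ) / ell D ^ 15 := by
  have hL0 : 0 < ell D := by linarith
  have hL1 : 1 ≤ ell D := by linarith
  have hℓ3 : 3 ≤ ell D := by linarith
  have hlog2 : 2 ≤ Real.log D := by have h := hL5; rw [ell] at h; linarith
  have hP0 : 0 < bigP D := Real.exp_pos _
  have hT0 : 0 < bigT D := Real.exp_pos _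
  have hlogP : Real.log (bigP D) = ell D ^ 9 := log_bigP D
  have hαeq : alpha D = π / ell D ^ 9 := by rw [alpha, bigP, Real.log_exp]
  obtain ⟨⟨h31, h3P⟩, hT3, -, ⟨hT2, h2P⟩, -, ⟨hnP, -, -⟩⟩ := mid_xfacts hL5 hn1 hlo hhi
  obtain ⟨-, -, h498_5, -, -, h5_P, -⟩ := Ranges1422.range_facts (D := D) hℓ3
  have hμ6 : betaMu D 6 = beta6 D := by simp [betaMu]
  have hμ7 : betaMu D 7 = beta7 D := by simp [betaMu]
  have e6' := H₂ 6 (by simp) _ (hT3 hmain) h3P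
  have e7' := H₂ 7 (by simp) _ hT2 h2P
  rw [hμ6] at e6'; rw [hμ7] at e7'
  have e6 := e6'.trans (mul_le_mul_of_nonneg_right (le_abs_self C₂) (by positivity))
  have e7 := e7'.trans (mul_le_mul_of_nonneg_right (le_abs_self C₂) (by positivity))
  have hLp : ‖deriv χ.LFunction 1‖ ≤ 4 * Real.exp (9 / 2) * ell D ^ 2 := norm_deriv_LFunction_one_le χ hℓ3 hp
  have hshift := norm_frakfW7_P2_div_sub_le c' hL5 hc5 j hn1 hlo (hhi.trans_le h498_5)
  have hι := norm_iota34_le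
  have hι3 : ‖conj iota3‖ ≤ 1.25 := by rw [RCLike.norm_conj]; exact hι.1
  have hι4 : ‖conj iota4‖ ≤ 2.3 := by rw [RCLike.norm_conj]; exact hι.2
  have hΛ3n : ‖((0.498 * Real.log (bigP D) : ℝ) : ℂ)‖ = 0.498 * ell D ^ 9 := by
    rw [Complex.norm_real, hlogP, Real.norm_of_nonneg (by positivity)]
  have hlogP2pos : 0 < Real.log (Skeleton.P2 D) := Real.log_pos (one_lt_P2 hlog2)
  have hΛ2n : ‖(Real.log (Skeleton.P2 D) : ℂ)‖ = Real.log (Skeleton.P2 D) := by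
    rw [Complex.norm_real, Real.norm_of_nonneg hlogP2pos.le]
  have hlogT : Real.log (bigT D) = ell D ^ (1.1 : ℝ) := by rw [bigT, Real.log_exp]
  have hτ2 := (bigT_lt_rpow hL5).1
  have hlogP2ge : 0.4 * ell D ^ 9 ≤ Real.log (Skeleton.P2 D) := by
    have h7 : (78125 : ℝ) ≤ ell D ^ 7 := by
      calc (78125 : ℝ) = 5 ^ 7 := by norm_num
        _ ≤ ell D ^ 7 := pow_le_pow_left₀ (by norm_num) hL5 7
    have h9 : ell D ^ 9 = ell D ^ 2 * ell D ^ 7 := by ring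
    rw [Skeleton.P2, Real.log_div (Real.rpow_pos_of_pos hP0 _).ne' (pow_pos hT0 10).ne',
      Real.log_rpow hP0, Real.log_pow, hlogT, hlogP]
    push_cast
    nlinarith [pow_nonneg hL0.le 2]
  -- rewrite the `m`-sum
  have hP3eq : Skeleton.P3 D = bigP D ^ (0.498 : ℝ) := rfl
  have hlogP3 : (Real.log (Skeleton.P3 D) : ℂ) = ((0.498 * Real.log (bigP D) : ℝ) : ℂ) := by
    rw [Skeleton.P3, Real.log_rpow hP0]
  rw [mSum12_eq c' χ hlog2 j hn1 le_rfl, Nat.mul_one, hlogP3]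
  have h := norm_M_sub_M0_le (cι₃ := conj iota3) (cι₄ := conj iota4)
    (f6 := frakfW c' D j 6 (bigP D ^ (0.498 : ℝ) / n)) (f7 := frakfW c' D j 7 (Skeleton.P2 D / n))
    (f7' := frakfW c' D j 7 (bigP D ^ (0.5 : ℝ) / n)) (Lp := deriv χ.LFunction 1)
    (Λ₃ := (((0.498 * Real.log (bigP D) : ℝ)) : ℂ)) (Λ₂ := (Real.log (Skeleton.P2 D) : ℂ))
    (Λ₅ := (((0.5 * Real.log (bigP D) : ℝ)) : ℂ)) (L2 := 0.4 * ell D ^ 9)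
    (lp := 4 * Real.exp (9 / 2) * ell D ^ 2) hι3 hι4 e6 e7 hΛ3n
    (by rw [hΛ2n]; exact hlogP2ge) (by positivity) (by positivity) hLp hshift
  refine h.trans ?_
  rw [hαeq]
  -- `τ = 𝓛^{1.1} = ℓσ`-free form: use `ℓ ≤ τ`... here directly in `τ`
  set ℓ := ell D with hℓ
  set τ := ell D ^ (1.1 : ℝ) with hτ
  have hτℓ : ℓ ≤ τ := by
    rw [hτ, hℓ]
    calc ell D = ell D ^ (1 : ℝ) := (Real.rpow_one _).symm
      _ ≤ ell D ^ (1.1 : ℝ) := Real.rpow_le_rpow_of_exponent_le hL1 (by norm_num)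
  have hτ1 : 1 ≤ τ := hL1.trans hτℓ
  -- `τ = ℓ * (τ/ℓ)` with `τ/ℓ ≥ 1`
  have hσ : 1 ≤ τ / ℓ := by rw [le_div_iff₀ hL0, one_mul]; exact hτℓ
  have hτeq : τ = ℓ * (τ / ℓ) := by field_simp
  rw [hτeq]
  exact eM_arith (b := |C₂|) (cL := 4 * Real.exp (9 / 2)) hL1 hσ (abs_nonneg C₂) (by positivity)

/-- **M-side, the printed main term**: `‖M₀(n)‖ ≤ 207·4e^{9/2}/𝓛⁷` on the middle range
(`|𝔣_{jμ}| ≤ 29`, `|L′(1,χ)| ≤ 4e^{9/2}𝓛²`). [cite: Zhang2022LandauSiegel, §10 p. 61] -/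
theorem mid_M0_le (hL5 : 5 ≤ ell D) (hc5 : 5 * |c'| * alpha D * ell D ≤ 1) (hp : χ.IsPrimitive)
    (j : ℕ) {n : ℕ} (hn1 : 1 ≤ n) (hlo : bigP D ^ (0.496 : ℝ) ≤ (n : ℝ))
    (hhi : (n : ℝ) < bigP D ^ (0.498 : ℝ)) :
    ‖deriv χ.LFunction 1 *
        (conj iota3 * frakfW c' D j 6 (bigP D ^ (0.498 : ℝ) / n) / ((0.498 * Real.log (bigP D) : ℝ) : ℂ) +
          conj iota4 * frakfW c' D j 7 (bigP D ^ (0.5 : ℝ) / n) / ((0.5 * Real.log (bigP D) : ℝ) : ℂ))‖ ≤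
      207 * (4 * Real.exp (9 / 2)) / ell D ^ 7 := by
  have hL0 : 0 < ell D := by linarith
  have hℓ3 : 3 ≤ ell D := by linarith
  have hlogP : Real.log (bigP D) = ell D ^ 9 := log_bigP D
  have hα : 0 < alpha D := by rw [alpha, bigP, Real.log_exp]; positivity
  have hΛ4 : alpha D * Real.log (bigP D) ≤ 4 := by
    rw [alpha, div_mul_cancel₀ _ (by rw [hlogP]; positivity)]; linarith [Real.pi_lt_four]
  obtain ⟨-, -, -, -, -, ⟨hnP, -, -⟩⟩ := mid_xfacts hL5 hn1 hlo hhi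
  obtain ⟨h496_2, h496_498, h498_5, -, -, h5_P, -⟩ := Ranges1422.range_facts (D := D) hℓ3
  have hLp : ‖deriv χ.LFunction 1‖ ≤ 4 * Real.exp (9 / 2) * ell D ^ 2 := norm_deriv_LFunction_one_le χ hℓ3 hp
  have hf6 : ‖frakfW c' D j 6 (bigP D ^ (0.498 : ℝ) / n)‖ ≤ 29 :=
    (Section8AbelProfiles.frakfW_div_bounds c' j 6 hα hL0.le hc5 (by linarith) (by linarith)
      (by exact_mod_cast hn1) hnP hΛ4).2.1
  have hf7 : ‖frakfW c' D j 7 (bigP D ^ (0.5 : ℝ) / n)‖ ≤ 29 :=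
    (Section8AbelProfiles.frakfW_div_bounds c' j 7 hα hL0.le hc5 (by linarith) h5_P
      (by exact_mod_cast hn1) hnP hΛ4).2.1
  have hι := norm_iota34_le
  have hι3 : ‖conj iota3‖ ≤ 1.25 := by rw [RCLike.norm_conj]; exact hι.1
  have hι4 : ‖conj iota4‖ ≤ 2.3 := by rw [RCLike.norm_conj]; exact hι.2
  have hΛ3n : ‖((0.498 * Real.log (bigP D) : ℝ) : ℂ)‖ = 0.498 * ell D ^ 9 := by
    rw [Complex.norm_real, hlogP, Real.norm_of_nonneg (by positivity)]
  have hΛ5n : ‖((0.5 * Real.log (bigP D) : ℝ) : ℂ)‖ = 0.5 * ell D ^ 9 := by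
    rw [Complex.norm_real, hlogP, Real.norm_of_nonneg (by positivity)]
  have h := norm_M0_le (cι₃ := conj iota3) (cι₄ := conj iota4)
    (f6 := frakfW c' D j 6 (bigP D ^ (0.498 : ℝ) / n)) (f7' := frakfW c' D j 7 (bigP D ^ (0.5 : ℝ) / n))
    (Lp := deriv χ.LFunction 1) (Λ₃ := (((0.498 * Real.log (bigP D) : ℝ)) : ℂ))
    (Λ₅ := (((0.5 * Real.log (bigP D) : ℝ)) : ℂ)) (lp := 4 * Real.exp (9 / 2) * ell D ^ 2) hι3 hι4 hf6 hf7 hΛ3n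
    hΛ5n (by positivity) (by positivity) hLp
  exact h.trans (BM_arith (cL := 4 * Real.exp (9 / 2)) hL0 (by positivity))

/-- **M-side, crude** (any `n` of the middle range; used on the windows): `‖mSum12(n)‖ ≤
(240·4e^{9/2} + 9|C₂| + 6)𝓛^{2.2}/𝓛⁹` (Lemma 8.2 where it reaches, `norm_lemma82Sum_crude` for
`P₃/n ≤ T`). [cite: Zhang2022LandauSiegel, §10 p. 61] -/
theorem mid_M_crude_le (hL5 : 5 ≤ ell D) (hc5 : 5 * |c'| * alpha D * ell D ≤ 1) (hp : χ.IsPrimitive)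
    (j : ℕ) {C₂ : ℝ}
    (H₂ : ∀ μ ∈ ({6, 7} : Finset ℕ), ∀ y : ℝ, bigT D < y → y < bigP D →
      ‖(∑ m ∈ Finset.Ico 1 ⌈y⌉₊, χ (m : ZMod D) / (m : ℂ) ^ (1 - betaJ c' D j) *
            ((y / m : ℝ) : ℂ) ^ betaMu D μ * (Real.log (y / m) : ℂ)) -
          deriv χ.LFunction 1 * frakfW c' D j μ y‖ ≤ C₂ * (ell D ^ 6)⁻¹)
    {n : ℕ} (hn1 : 1 ≤ n) (hlo : bigP D ^ (0.496 : ℝ) ≤ (n : ℝ)) (hhi : (n : ℝ) < bigP D ^ (0.498 : ℝ)) :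
    ‖Sec10C.mSum12 c' χ j n 1‖ ≤
      (240 * (4 * Real.exp (9 / 2)) + 9 * |C₂| + 6) * (ell D ^ (1.1 : ℝ)) ^ 2 / ell D ^ 9 := by
  have hL0 : 0 < ell D := by linarith
  have hL1 : 1 ≤ ell D := by linarith
  have hℓ3 : 3 ≤ ell D := by linarith
  have hlog2 : 2 ≤ Real.log D := by have h := hL5; rw [ell] at h; linarith
  have hP0 : 0 < bigP D := Real.exp_pos _
  have hT0 : 0 < bigT D := Real.exp_pos _
  have hlogP : Real.log (bigP D) = ell D ^ 9 := log_bigP D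
  have hα : 0 < alpha D := by rw [alpha, bigP, Real.log_exp]; positivity
  have hΛ4 : alpha D * Real.log (bigP D) ≤ 4 := by
    rw [alpha, div_mul_cancel₀ _ (by rw [hlogP]; positivity)]; linarith [Real.pi_lt_four]
  obtain ⟨⟨h31, h3P⟩, hT3, hlog3, ⟨hT2, h2P⟩, -, ⟨hnP, -, -⟩⟩ := mid_xfacts hL5 hn1 hlo hhi
  obtain ⟨h496_2, h496_498, h498_5, -, -, h5_P, -⟩ := Ranges1422.range_facts (D := D) hℓ3
  have hμ6 : betaMu D 6 = beta6 D := by simp [betaMu]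
  have hμ7 : betaMu D 7 = beta7 D := by simp [betaMu]
  have hLp : ‖deriv χ.LFunction 1‖ ≤ 4 * Real.exp (9 / 2) * ell D ^ 2 := norm_deriv_LFunction_one_le χ hℓ3 hp
  set cL : ℝ := 4 * Real.exp (9 / 2) with hcL
  set τ : ℝ := ell D ^ (1.1 : ℝ) with hτ
  have hτℓ : ell D ≤ τ := by
    rw [hτ]
    calc ell D = ell D ^ (1 : ℝ) := (Real.rpow_one _).symm
      _ ≤ ell D ^ (1.1 : ℝ) := Real.rpow_le_rpow_of_exponent_le hL1 (by norm_num)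
  have hℓ6 : (ell D ^ 6)⁻¹ ≤ 1 := inv_le_one_of_one_le₀ (one_le_pow₀ hL1)
  -- `S7` is always main
  have hS7 : ‖∑ m ∈ Finset.Ico 1 ⌈Skeleton.P2 D / n⌉₊, χ (m : ZMod D) / (m : ℂ) ^ (1 - betaJ c' D j) *
      (((Skeleton.P2 D / n) / m : ℝ) : ℂ) ^ beta7 D * (Real.log ((Skeleton.P2 D / n) / m) : ℂ)‖ ≤
      29 * (cL * ell D ^ 2) + |C₂| := by
    have e7 := H₂ 7 (by simp) _ hT2 h2P
    rw [hμ7] at e7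
    have hfb : ‖frakfW c' D j 7 (Skeleton.P2 D / n)‖ ≤ 29 := by
      have hQ1 : 1 ≤ Skeleton.P2 D := (one_lt_P2 hlog2).le
      have hQP : Skeleton.P2 D ≤ bigP D := by
        have : Skeleton.P2 D ≤ bigP D ^ (0.5 : ℝ) := (range_sizes (D := D) hlog2).2.1
        linarith
      exact (Section8AbelProfiles.frakfW_div_bounds c' j 7 hα hL0.le hc5 hQ1 hQP
        (by exact_mod_cast hn1) hnP hΛ4).2.1
    have hm : ‖deriv χ.LFunction 1 * frakfW c' D j 7 (Skeleton.P2 D / n)‖ ≤ cL * ell D ^ 2 * 29 := by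
      rw [norm_mul]; exact mul_le_mul hLp hfb (norm_nonneg _) (by positivity)
    have := norm_le_of_sub_le e7 hm
    have h' : C₂ * (ell D ^ 6)⁻¹ ≤ |C₂| := by
      calc C₂ * (ell D ^ 6)⁻¹ ≤ |C₂| * (ell D ^ 6)⁻¹ := by gcongr; exact le_abs_self _
        _ ≤ |C₂| * 1 := by gcongr
        _ = |C₂| := mul_one _
    linarith
  have hS6 : ‖∑ m ∈ Finset.Ico 1 ⌈Skeleton.P3 D / n⌉₊, χ (m : ZMod D) / (m : ℂ) ^ (1 - betaJ c' D j) *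
      (((Skeleton.P3 D / n) / m : ℝ) : ℂ) ^ beta6 D * (Real.log ((Skeleton.P3 D / n) / m) : ℂ)‖ ≤
      29 * (cL * ell D ^ 2) + |C₂| + 2 * τ ^ 2 := by
    have hτ0 : 0 ≤ 2 * τ ^ 2 := by positivity
    by_cases hlt : (n : ℝ) < Skeleton.P3 D / bigT D
    · have e6 := H₂ 6 (by simp) _ (hT3 hlt) h3P
      rw [hμ6] at e6
      have hP3eq : Skeleton.P3 D = bigP D ^ (0.498 : ℝ) := rfl
      have hQ1 : 1 ≤ Skeleton.P3 D := by rw [hP3eq]; linarith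
      have hQP : Skeleton.P3 D ≤ bigP D := by rw [hP3eq]; linarith
      have hfb : ‖frakfW c' D j 6 (Skeleton.P3 D / n)‖ ≤ 29 :=
        (Section8AbelProfiles.frakfW_div_bounds c' j 6 hα hL0.le hc5 hQ1 hQP
          (by exact_mod_cast hn1) hnP hΛ4).2.1
      have hm : ‖deriv χ.LFunction 1 * frakfW c' D j 6 (Skeleton.P3 D / n)‖ ≤ cL * ell D ^ 2 * 29 := by
        rw [norm_mul]; exact mul_le_mul hLp hfb (norm_nonneg _) (by positivity)
      have := norm_le_of_sub_le e6 hm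
      have h' : C₂ * (ell D ^ 6)⁻¹ ≤ |C₂| := by
        calc C₂ * (ell D ^ 6)⁻¹ ≤ |C₂| * (ell D ^ 6)⁻¹ := by gcongr; exact le_abs_self _
          _ ≤ |C₂| * 1 := by gcongr
          _ = |C₂| := mul_one _
      linarith
    · have hcrude := norm_lemma82Sum_crude c' χ j h31.le
      have hlx := hlog3 (not_lt.mp hlt)
      have hlx0 : 0 ≤ Real.log (Skeleton.P3 D / n) := Real.log_nonneg h31.le
      have h0 : 0 ≤ 29 * (cL * ell D ^ 2) + |C₂| := by positivity
      calc _ ≤ (1 + Real.log (Skeleton.P3 D / n)) * Real.log (Skeleton.P3 D / n) := hcrude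
        _ ≤ (1 + τ) * τ := mul_le_mul (by linarith) hlx hlx0 (by positivity)
        _ ≤ 2 * τ ^ 2 := by nlinarith [hL1.trans hτℓ]
        _ ≤ 29 * (cL * ell D ^ 2) + |C₂| + 2 * τ ^ 2 := by linarith
  have hι := norm_iota34_le
  have hι3 : ‖conj iota3‖ ≤ 1.25 := by rw [RCLike.norm_conj]; exact hι.1
  have hι4 : ‖conj iota4‖ ≤ 2.3 := by rw [RCLike.norm_conj]; exact hι.2
  have hΛ3n : ‖((0.498 * Real.log (bigP D) : ℝ) : ℂ)‖ = 0.498 * ell D ^ 9 := by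
    rw [Complex.norm_real, hlogP, Real.norm_of_nonneg (by positivity)]
  have hlogP2pos : 0 < Real.log (Skeleton.P2 D) := Real.log_pos (one_lt_P2 hlog2)
  have hΛ2n : ‖(Real.log (Skeleton.P2 D) : ℂ)‖ = Real.log (Skeleton.P2 D) := by
    rw [Complex.norm_real, Real.norm_of_nonneg hlogP2pos.le]
  have hlogT : Real.log (bigT D) = τ := by rw [bigT, Real.log_exp]
  have hτ2 : τ ≤ ell D ^ 2 := (bigT_lt_rpow hL5).1
  have hlogP2ge : 0.4 * ell D ^ 9 ≤ Real.log (Skeleton.P2 D) := by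
    have h7 : (78125 : ℝ) ≤ ell D ^ 7 := by
      calc (78125 : ℝ) = 5 ^ 7 := by norm_num
        _ ≤ ell D ^ 7 := pow_le_pow_left₀ (by norm_num) hL5 7
    have h9 : ell D ^ 9 = ell D ^ 2 * ell D ^ 7 := by ring
    rw [Skeleton.P2, Real.log_div (Real.rpow_pos_of_pos hP0 _).ne' (pow_pos hT0 10).ne',
      Real.log_rpow hP0, Real.log_pow, hlogT, hlogP]
    push_cast
    nlinarith [pow_nonneg hL0.le 2]
  have hlogP3 : (Real.log (Skeleton.P3 D) : ℂ) = ((0.498 * Real.log (bigP D) : ℝ) : ℂ) := by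
    rw [Skeleton.P3, Real.log_rpow hP0]
  rw [mSum12_eq c' χ hlog2 j hn1 le_rfl, Nat.mul_one, hlogP3]
  have h := norm_M_le (cι₃ := conj iota3) (cι₄ := conj iota4)
    (Λ₃ := (((0.498 * Real.log (bigP D) : ℝ)) : ℂ)) (Λ₂ := (Real.log (Skeleton.P2 D) : ℂ))
    (L2 := 0.4 * ell D ^ 9) hι3 hι4 hS6 hS7 hΛ3n (by rw [hΛ2n]; exact hlogP2ge) (by positivity) (by positivity)
  exact h.trans (BW_arith (b := |C₂|) (cL := cL) hL1 hτℓ (abs_nonneg C₂) (by positivity))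

set_option maxHeartbeats 400000 in
/-- **N-side, main `n`**: with the shift-0 log-mean estimate in force at the modulus `D` (constant `C`)
and `P^{0.5} < y*(n) ≤ P^{0.502}/T` on the middle range: for every `r ∣ n`,
`‖nSum14(n/r, r) − (500L′/log P)Π(n/r,r)(−1 + 𝔶₁ⱼ(P^{0.004}n))‖ ≤ (1500|C| + 3.55·10⁶π·4e^{9/2})𝓛⁻¹⁵(n/φ(n))²`
(the shifted (10.9), `Lemma102.frakv2S_mid_of_key`, plus `𝔶₁ⱼ(y*) = 𝔶₁ⱼ(P^{0.004}n) + O(α𝓛)`).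
[cite: Zhang2022LandauSiegel, §10 p. 61, (10.9), Remark p. 57] -/
theorem mid_N_main_le (hL5 : 5 ≤ ell D) (hcαL : |c'| * alpha D * ell D ≤ 1) (hp : χ.IsPrimitive)
    (j : ℕ) {C : ℝ}
    (HA : ∀ d r : ℕ, 1 ≤ d → 1 ≤ r → ((d * r : ℕ) : ℝ) < bigP D / bigT D ^ 2 →
      ∀ x : ℝ, bigT D ≤ x → x ≤ bigP D →
        ‖(∑ n ∈ Finset.Ioc 0 ⌊x⌋₊, χ (n : ZMod D) * xiZero c' D j n d r / (n : ℂ) *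
              (Real.log (x / n) : ℂ)) -
            deriv χ.LFunction 1 * PiW χ d r *
              (1 + (betaJ c' D (j + 1) + betaJ c' D (j + 2)) * (Real.log x : ℂ) +
                betaJ c' D (j + 1) * betaJ c' D (j + 2) * (Real.log x : ℂ) ^ 2 / 2)‖ ≤
          C * (ell D ^ 6)⁻¹ * (∏ q ∈ (d * r).primeFactors, (1 - (q : ℝ)⁻¹)⁻¹) ^ 2)
    {n : ℕ} (hn1 : 1 ≤ n) (hlo : bigP D ^ (0.496 : ℝ) ≤ (n : ℝ)) (hhi : (n : ℝ) < bigP D ^ (0.498 : ℝ))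
    {r : ℕ} (hr : r ∈ n.divisors) (hm1 : bigP D ^ (0.5 : ℝ) < yShift D (n : ℝ))
    (hm2 : yShift D (n : ℝ) ≤ bigP D ^ (0.502 : ℝ) / bigT D) :
    ‖Sec10C.nSum14 c' χ j (n / r) r - 500 * deriv χ.LFunction 1 / (Real.log (bigP D) : ℂ) *
        PiW χ (n / r) r * (-1 + fraky1 c' D j (bigP D ^ (0.004 : ℝ) * n))‖ ≤
      (1500 * |C| + 3550000 * π * (4 * Real.exp (9 / 2))) / ell D ^ 15 * ((n : ℝ) / Nat.totient n) ^ 2 := by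
  have hL0 : 0 < ell D := by linarith
  have hL1 : 1 ≤ ell D := by linarith
  have hℓ3 : 3 ≤ ell D := by linarith
  have hn0 : n ≠ 0 := by omega
  have hD2 : 2 ≤ D := by
    by_contra h
    have h2 : D < 2 := not_le.mp h
    interval_cases D <;> simp [ell] at hL5 <;> linarith
  have hP1 : 1 < bigP D := by rw [bigP]; exact Real.one_lt_exp_iff.mpr (by positivity)
  have hlogP : Real.log (bigP D) = ell D ^ 9 := log_bigP D
  have hα : 0 < alpha D := by rw [alpha, bigP, Real.log_exp]; positivity
  have hαeq : alpha D = π / ell D ^ 9 := by rw [alpha, bigP, Real.log_exp]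
  have hr0 : 0 < r := Nat.pos_of_mem_divisors hr
  have hrn : r ∣ n := (Nat.mem_divisors.mp hr).1
  have hnr : n / r * r = n := Nat.div_mul_cancel hrn
  have hd1 : 1 ≤ n / r := Nat.div_pos (Nat.le_of_dvd (by omega) hrn) hr0
  have hcast : ((n / r * r : ℕ) : ℝ) = n := by rw [hnr]
  obtain ⟨-, -, -, -, -, ⟨-, hnPT, -⟩⟩ := mid_xfacts hL5 hn1 hlo hhi
  obtain ⟨-, -, h498_5, -, -, -, -⟩ := Ranges1422.range_facts (D := D) hℓ3
  have key := HA (n / r) r hd1 hr0 (by rw [hcast]; exact hnPT)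
  have hmid := Lemma102.frakv2S_mid_of_key χ c' j hd1 hr0 hP1 hD2 key
    (by rw [hcast]; exact hm1) (by rw [hcast]; exact hm2)
  rw [hcast] at hmid
  have hNeq : Sec10C.nSum14 c' χ j (n / r) r = frakv2S c' χ j (n / r) r :=
    Sec10C.nSum14_eq_frakv2S c' χ hℓ3 j hd1 hr0
  have hR : (∏ q ∈ (n / r * r).primeFactors, (1 - (q : ℝ)⁻¹)⁻¹) ^ 2 = ((n : ℝ) / Nat.totient n) ^ 2 := by
    rw [hnr, prod_primeFactors_eq n hn0]
  have hPi : ‖PiW χ (n / r) r‖ ≤ ((n : ℝ) / Nat.totient n) ^ 2 := by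
    have h := norm_PiW_le χ (d := n / r) (r := r) (by omega) (by omega)
    rwa [hnr] at h
  have hLp : ‖deriv χ.LFunction 1‖ ≤ 4 * Real.exp (9 / 2) * ell D ^ 2 :=
    norm_deriv_LFunction_one_le χ hℓ3 hp
  have hc₀n : ‖500 * deriv χ.LFunction 1 / (Real.log (bigP D) : ℂ)‖ ≤ 500 * (4 * Real.exp (9 / 2)) / ell D ^ 7 := by
    rw [norm_div, norm_mul, Complex.norm_real, hlogP, Real.norm_of_nonneg (by positivity)]
    have h500 : ‖(500 : ℂ)‖ = 500 := by norm_num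
    rw [h500, show 500 * (4 * Real.exp (9 / 2)) / ell D ^ 7 =
      500 * (4 * Real.exp (9 / 2) * ell D ^ 2) / ell D ^ 9 by field_simp]
    gcongr
  have hys := norm_fraky1_yShift_sub_le c' hL5 hcαL j hlo (le_of_lt (hhi.trans_le h498_5))
  rw [hNeq, N_sub_eq]
  calc _ ≤ ‖frakv2S c' χ j (n / r) r - 500 * deriv χ.LFunction 1 * PiW χ (n / r) r /
            (Real.log (bigP D) : ℂ) * (-1 + fraky1 c' D j (yShift D (n : ℝ)))‖ +
        ‖500 * deriv χ.LFunction 1 / (Real.log (bigP D) : ℂ)‖ * ‖PiW χ (n / r) r‖ *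
          ‖fraky1 c' D j (yShift D (n : ℝ)) - fraky1 c' D j (bigP D ^ (0.004 : ℝ) * n)‖ := by
        refine (norm_add_le _ _).trans (add_le_add le_rfl ?_)
        rw [norm_mul, norm_mul]
    _ ≤ 1500 * (C * (ell D ^ 6)⁻¹ * ((n : ℝ) / Nat.totient n) ^ 2) / Real.log (bigP D) +
        (500 * (4 * Real.exp (9 / 2)) / ell D ^ 7) * ((n : ℝ) / Nat.totient n) ^ 2 *
          (7100 * alpha D * ell D) := by
        refine add_le_add ?_ ?_
        · rw [← hR]; exact hmid
        · exact mul_le_mul (mul_le_mul hc₀n hPi (norm_nonneg _) (by positivity)) hys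
            (norm_nonneg _) (by positivity)
    _ ≤ _ := by
        rw [hlogP, hαeq]
        exact eN_arith (C := C) (cL := 4 * Real.exp (9 / 2)) hL0 (by positivity)

set_option maxHeartbeats 400000 in
/-- **N-side, window `n`** (any `n` of the middle range, any `r ∣ n`): `‖nSum14(n/r, r)‖ ≤
2000(220·4e^{9/2} + |C| + 16|C_ξ|)·𝓛(𝓛^{1.1})⁴/𝓛⁹·(n/φ(n))²` — from the tent decomposition, the log-mean
estimate above `T` and `XiZeroMajorant.xiZeroTailMean` below `T`. [cite: Zhang2022LandauSiegel, §10 p. 61, (10.11)] -/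
theorem mid_N_window_le (hL5 : 5 ≤ ell D) (hcαL : |c'| * alpha D * ell D ≤ 1) (hp : χ.IsPrimitive)
    (j : ℕ) {C Cξ : ℝ}
    (HA : ∀ d r : ℕ, 1 ≤ d → 1 ≤ r → ((d * r : ℕ) : ℝ) < bigP D / bigT D ^ 2 →
      ∀ x : ℝ, bigT D ≤ x → x ≤ bigP D →
        ‖(∑ n ∈ Finset.Ioc 0 ⌊x⌋₊, χ (n : ZMod D) * xiZero c' D j n d r / (n : ℂ) *
              (Real.log (x / n) : ℂ)) -
            deriv χ.LFunction 1 * PiW χ d r *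
              (1 + (betaJ c' D (j + 1) + betaJ c' D (j + 2)) * (Real.log x : ℂ) +
                betaJ c' D (j + 1) * betaJ c' D (j + 2) * (Real.log x : ℂ) ^ 2 / 2)‖ ≤
          C * (ell D ^ 6)⁻¹ * (∏ q ∈ (d * r).primeFactors, (1 - (q : ℝ)⁻¹)⁻¹) ^ 2)
    (Hξ : ∀ d r : ℕ, 1 ≤ d → 1 ≤ r → ((d * r : ℕ) : ℝ) < Skeleton.P1 D → ∀ x : ℝ, 1 ≤ x → x ≤ bigT D →
      ∑ n ∈ Finset.Ico 1 ⌈x⌉₊, ‖xiZero c' D j n d r‖ / n ≤ Cξ * ell D * (1 + Real.log x) ^ 3)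
    {n : ℕ} (hn1 : 1 ≤ n) (hlo : bigP D ^ (0.496 : ℝ) ≤ (n : ℝ)) (hhi : (n : ℝ) < bigP D ^ (0.498 : ℝ))
    {r : ℕ} (hr : r ∈ n.divisors) :
    ‖Sec10C.nSum14 c' χ j (n / r) r‖ ≤
      2000 * (220 * (4 * Real.exp (9 / 2)) + |C| + 16 * |Cξ|) * ell D * (ell D ^ (1.1 : ℝ)) ^ 4 /
        ell D ^ 9 * ((n : ℝ) / Nat.totient n) ^ 2 := by
  have hL0 : 0 < ell D := by linarith
  have hL1 : 1 ≤ ell D := by linarith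
  have hℓ3 : 3 ≤ ell D := by linarith
  have hn0 : n ≠ 0 := by omega
  have hD2 : 2 ≤ D := by
    by_contra h
    have h2 : D < 2 := not_le.mp h
    interval_cases D <;> simp [ell] at hL5 <;> linarith
  have hP0 : 0 < bigP D := Real.exp_pos _
  have hP1 : 1 < bigP D := by rw [bigP]; exact Real.one_lt_exp_iff.mpr (by positivity)
  have hT0 : 0 < bigT D := Real.exp_pos _
  have hlogP : Real.log (bigP D) = ell D ^ 9 := log_bigP D
  have hα : 0 < alpha D := by rw [alpha, bigP, Real.log_exp]; positivity
  have hαL : alpha D * ell D ^ 9 = π := by rw [alpha, bigP, Real.log_exp]; field_simp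
  set τ : ℝ := ell D ^ (1.1 : ℝ) with hτ
  have hlogT : Real.log (bigT D) = τ := by rw [bigT, Real.log_exp]
  have hτℓ : ell D ≤ τ := by
    rw [hτ]
    calc ell D = ell D ^ (1 : ℝ) := (Real.rpow_one _).symm
      _ ≤ ell D ^ (1.1 : ℝ) := Real.rpow_le_rpow_of_exponent_le hL1 (by norm_num)
  have hτ1 : 1 ≤ τ := hL1.trans hτℓ
  have hr0 : 0 < r := Nat.pos_of_mem_divisors hr
  have hrn : r ∣ n := (Nat.mem_divisors.mp hr).1
  have hnr : n / r * r = n := Nat.div_mul_cancel hrn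
  have hd1 : 1 ≤ n / r := Nat.div_pos (Nat.le_of_dvd (by omega) hrn) hr0
  have hcast : ((n / r * r : ℕ) : ℝ) = n := by rw [hnr]
  obtain ⟨-, -, -, -, -, ⟨-, hnPT, hnP1⟩⟩ := mid_xfacts hL5 hn1 hlo hhi
  have key := HA (n / r) r hd1 hr0 (by rw [hcast]; exact hnPT)
  have hξ := Hξ (n / r) r hd1 hr0 (by rw [hcast]; exact hnP1)
  have hNeq : Sec10C.nSum14 c' χ j (n / r) r = frakv2S c' χ j (n / r) r :=
    Sec10C.nSum14_eq_frakv2S c' χ hℓ3 j hd1 hr0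
  have hR : (∏ q ∈ (n / r * r).primeFactors, (1 - (q : ℝ)⁻¹)⁻¹) ^ 2 = ((n : ℝ) / Nat.totient n) ^ 2 := by
    rw [hnr, prod_primeFactors_eq n hn0]
  have hw1 : 1 ≤ ((n : ℝ) / Nat.totient n) ^ 2 := one_le_pow₀ (one_le_self_div_totient hn0)
  have hPi : ‖PiW χ (n / r) r‖ ≤ ((n : ℝ) / Nat.totient n) ^ 2 := by
    have h := norm_PiW_le χ (d := n / r) (r := r) (by omega) (by omega)
    rwa [hnr] at h
  have hys1 : 1 ≤ yShift D ((n / r * r : ℕ) : ℝ) := by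
    rw [hcast]
    exact (by exact_mod_cast hn1 : (1 : ℝ) ≤ n).trans (Lemma102.le_yShift hL5 (by positivity))
  have hLp : ‖deriv χ.LFunction 1‖ ≤ 4 * Real.exp (9 / 2) * ell D ^ 2 :=
    norm_deriv_LFunction_one_le χ hℓ3 hp
  set cL : ℝ := 4 * Real.exp (9 / 2) with hcL
  set Bn : ℝ := (220 * (cL * ell D ^ 2) + |C| + 16 * |Cξ| * ell D * τ ^ 4) * ((n : ℝ) / Nat.totient n) ^ 2
    with hBn
  have hBn0 : 0 ≤ Bn := by positivity
  have hB : ∀ X : ℝ, X ≤ bigP D →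
      ‖∑ m ∈ Finset.Ioc 0 ⌊X⌋₊, χ (m : ZMod D) * xiZero c' D j m (n / r) r / (m : ℂ) *
          (Real.log (X / m) : ℂ)‖ ≤ Bn := by
    intro X hXP
    by_cases hX1 : X < 1
    · rw [Lemma102.logMean_eq_zero_of_lt_one _ hX1, norm_zero]; exact hBn0
    rw [not_lt] at hX1
    by_cases hXT : X ≤ bigT D
    · -- below `T`: `xiZeroTailMean`
      have h1 := norm_logMean_le_log_mul χ (fun m => xiZero c' D j m (n / r) r) hX1
      have h2 := hξ X hX1 hXT
      have hlogX : Real.log X ≤ τ := by rw [← hlogT]; exact Real.log_le_log (by linarith) hXT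
      have hlogX0 : 0 ≤ Real.log X := Real.log_nonneg hX1
      have hsum0 : 0 ≤ Cξ * ell D * (1 + Real.log X) ^ 3 :=
        le_trans (Finset.sum_nonneg fun m _ => by positivity) h2
      calc _ ≤ Real.log X * ∑ m ∈ Finset.Ico 1 ⌈X⌉₊, ‖xiZero c' D j m (n / r) r‖ / m := h1
        _ ≤ Real.log X * (Cξ * ell D * (1 + Real.log X) ^ 3) := by gcongr
        _ ≤ 16 * |Cξ| * ell D * τ ^ 4 * ((n : ℝ) / Nat.totient n) ^ 2 :=
            window_crude_arith (cξ := |Cξ|) hL0 hτ1 hlogX0 hlogX hw1 (le_abs_self Cξ) hsum0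
        _ ≤ Bn := by
            rw [hBn]
            have h0 : 0 ≤ (220 * (cL * ell D ^ 2) + |C|) * ((n : ℝ) / Nat.totient n) ^ 2 := by positivity
            nlinarith
    · -- above `T`: main term + error
      rw [not_le] at hXT
      have e := key X hXT.le hXP
      have hlogX0 : 0 ≤ Real.log X := Real.log_nonneg hX1
      have hlogXP : Real.log X ≤ ell D ^ 9 := by rw [← hlogP]; exact Real.log_le_log (by linarith) hXP
      have hm := norm_logMean_main_le c' hcαL hα hαL hL0.le j (deriv χ.LFunction 1) (PiW χ (n / r) r)
        hlogX0 hlogXP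
      rw [hR] at e
      have hm' : ‖deriv χ.LFunction 1 * PiW χ (n / r) r *
          (1 + (betaJ c' D (j + 1) + betaJ c' D (j + 2)) * (Real.log X : ℂ) +
            betaJ c' D (j + 1) * betaJ c' D (j + 2) * (Real.log X : ℂ) ^ 2 / 2)‖ ≤
          ‖deriv χ.LFunction 1‖ * ((n : ℝ) / Nat.totient n) ^ 2 * (1 + 12 * π + 18 * π ^ 2) :=
        hm.trans (by gcongr)
      calc _ ≤ ‖deriv χ.LFunction 1‖ * ((n : ℝ) / Nat.totient n) ^ 2 * (1 + 12 * π + 18 * π ^ 2) +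
            C * (ell D ^ 6)⁻¹ * ((n : ℝ) / Nat.totient n) ^ 2 := norm_le_of_sub_le e hm'
        _ ≤ (220 * (cL * ell D ^ 2) + |C|) * ((n : ℝ) / Nat.totient n) ^ 2 := by
            rw [add_comm]
            exact window_main_arith (C := C) (cL := cL) hL1 (by positivity) (norm_nonneg _) hLp
        _ ≤ Bn := by
            rw [hBn]
            have t3 : 0 ≤ 16 * |Cξ| * ell D * τ ^ 4 * ((n : ℝ) / Nat.totient n) ^ 2 := by positivity
            nlinarith
  have hfr := norm_frakv2S_le_of_logMean_le c' χ j hd1 hr0 hP1 hD2 hys1 hB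
  rw [hNeq]
  refine hfr.trans ?_
  rw [hlogP, hBn]
  exact eW_arith (a := |C|) (cL := cL) (cξ := |Cξ|) hL1 hτℓ (abs_nonneg C) (by positivity) (abs_nonneg Cξ)
    (by positivity)

omit [NeZero D] in
/-- **G-side**: `|−1 + 𝔶₁ⱼ(P^{0.004}n)| ≤ 2` on the middle range. [cite: Zhang2022LandauSiegel, §10 (10.9)] -/
theorem mid_G_le (hL5 : 5 ≤ ell D) (hcαL : |c'| * alpha D * ell D ≤ 1) (j : ℕ) {n : ℕ} (hn1 : 1 ≤ n)
    (hlo : bigP D ^ (0.496 : ℝ) ≤ (n : ℝ)) (hhi : (n : ℝ) < bigP D ^ (0.498 : ℝ)) :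
    ‖-1 + fraky1 c' D j (bigP D ^ (0.004 : ℝ) * n)‖ ≤ 2 := by
  have hL0 : 0 < ell D := by linarith
  have hα : 0 < alpha D := by rw [alpha, bigP, Real.log_exp]; positivity
  have hαL : alpha D * ell D ^ 9 = π := by rw [alpha, bigP, Real.log_exp]; field_simp
  obtain ⟨-, -, -, -, ⟨g1, g2, g3⟩, -⟩ := mid_xfacts hL5 hn1 hlo hhi
  exact norm_fraky1_sub_le hcαL hα hαL hL0.le j g1 g2 g3

end PerN

/-! ## The weights of the middle range and of its windows -/

omit χ in
/-- `Σ_{n ∈ S}(n/φ(n))⁷/n ≤ 0.003e²⁵⁶𝓛⁹` for any set `S` of integers in `[P^{0.496}, P^{0.498})` (`𝓛 ≥ 5`).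
[cite: Zhang2022LandauSiegel, §10 p. 61] -/
theorem mid_weight_main_le (hL5 : 5 ≤ ell D) (S : Finset ℕ)
    (hS : ∀ n ∈ S, 1 ≤ n ∧ bigP D ^ (0.496 : ℝ) ≤ (n : ℝ) ∧ (n : ℝ) < bigP D ^ (0.498 : ℝ)) :
    ∑ n ∈ S, ((n : ℝ) / Nat.totient n) ^ 7 / n ≤ 0.003 * Real.exp 256 * ell D ^ 9 := by
  have hL0 : 0 < ell D := by linarith
  have h59 : (1953125 : ℝ) ≤ ell D ^ 9 := by
    calc (1953125 : ℝ) = 5 ^ 9 := by norm_num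
      _ ≤ ell D ^ 9 := pow_le_pow_left₀ (by norm_num) hL5 9
  have hfull := weight_sum_exp_range 7 (A := 0.496 * ell D ^ 9) (B := 0.498 * ell D ^ 9) (by nlinarith)
    (by nlinarith) S (fun n hn => by
      obtain ⟨h1, h2, h3⟩ := hS n hn
      rw [bigP_rpow] at h2 h3
      exact ⟨h1, h2, h3⟩)
  refine hfull.trans ?_
  rw [show (2 : ℝ) ^ (7 + 1) = 256 by norm_num]
  have : 2 + (0.498 * ell D ^ 9 - 0.496 * ell D ^ 9) ≤ 0.003 * ell D ^ 9 := by linarith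
  calc Real.exp 256 * (2 + (0.498 * ell D ^ 9 - 0.496 * ell D ^ 9))
      ≤ Real.exp 256 * (0.003 * ell D ^ 9) := mul_le_mul_of_nonneg_left this (Real.exp_pos _).le
    _ = 0.003 * Real.exp 256 * ell D ^ 9 := by ring

omit χ in
/-- **The window weight**: for any set `S` of integers `n ∈ [P^{0.496}, P^{0.498})` outside the main
sub-range (i.e. `n ≥ P₃/T`, or `y*(n) ≤ P^{0.5}`, or `y*(n) > P^{0.502}/T`):
`Σ_{n∈S}(n/φ(n))⁷/n ≤ 525e²⁵⁶𝓛^{1.1}` — the windows have logarithmic lengths `log(Dt₀) ≤ 520𝓛` and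
`log T = 𝓛^{1.1}`. [cite: Zhang2022LandauSiegel, §10 p. 61] -/
theorem mid_weight_window_le (hL5 : 5 ≤ ell D) (S : Finset ℕ)
    (hS : ∀ n ∈ S, 1 ≤ n ∧ bigP D ^ (0.496 : ℝ) ≤ (n : ℝ) ∧ (n : ℝ) < bigP D ^ (0.498 : ℝ) ∧
      (Skeleton.P3 D / bigT D ≤ (n : ℝ) ∨ yShift D (n : ℝ) ≤ bigP D ^ (0.5 : ℝ) ∨
        bigP D ^ (0.502 : ℝ) / bigT D < yShift D (n : ℝ))) :
    ∑ n ∈ S, ((n : ℝ) / Nat.totient n) ^ 7 / n ≤ 525 * Real.exp 256 * ell D ^ (1.1 : ℝ) := by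
  classical
  have hL0 : 0 < ell D := by linarith
  have hL1 : 1 ≤ ell D := by linarith
  have hP0 : 0 < bigP D := Real.exp_pos _
  have hT0 : 0 < bigT D := Real.exp_pos _
  have hD2 : 2 ≤ D := by
    by_contra h
    have h2 : D < 2 := not_le.mp h
    interval_cases D <;> simp [ell] at hL5 <;> linarith
  set τ : ℝ := ell D ^ (1.1 : ℝ) with hτ
  have hτℓ : ell D ≤ τ := by
    rw [hτ]
    calc ell D = ell D ^ (1 : ℝ) := (Real.rpow_one _).symm
      _ ≤ ell D ^ (1.1 : ℝ) := Real.rpow_le_rpow_of_exponent_le hL1 (by norm_num)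
  have hτ2 : τ ≤ ell D ^ 2 := (bigT_lt_rpow hL5).1
  have h59 : (1953125 : ℝ) ≤ ell D ^ 9 := by
    calc (1953125 : ℝ) = 5 ^ 9 := by norm_num
      _ ≤ ell D ^ 9 := pow_le_pow_left₀ (by norm_num) hL5 9
  -- `Dt₀`
  have hDt1 : 1 ≤ (D : ℝ) * t0 D := Lemma102.one_le_Dt0 hL1
  have hDt0 : 0 < (D : ℝ) * t0 D := by linarith
  set Δ : ℝ := Real.log ((D : ℝ) * t0 D) with hΔ
  have hΔ0 : 0 ≤ Δ := Real.log_nonneg hDt1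
  have hΔle : Δ ≤ 520 * ell D := by
    have hD0 : (0 : ℝ) < D := by exact_mod_cast (by omega : 0 < D)
    rw [hΔ, Real.log_mul hD0.ne' (by rw [t0]; positivity), t0, Real.log_pow]
    have : Real.log (ell D) ≤ ell D - 1 := Real.log_le_sub_one_of_pos hL0
    have hℓdef' : Real.log (D : ℝ) = ell D := rfl
    rw [hℓdef']; push_cast; linarith
  -- the two windows
  set lo : ℝ := bigP D ^ (0.496 : ℝ) with hlodef
  have hlo_exp : lo = Real.exp (0.496 * ell D ^ 9) := bigP_rpow D 0.496
  have hhi_exp : bigP D ^ (0.498 : ℝ) = Real.exp (0.498 * ell D ^ 9) := bigP_rpow D 0.498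
  have hP3T_exp : Skeleton.P3 D / bigT D = Real.exp (0.498 * ell D ^ 9 - τ) := by
    rw [Skeleton.P3, bigP_rpow, bigT, ← Real.exp_sub]
  have hloDt_exp : lo * ((D : ℝ) * t0 D) = Real.exp (0.496 * ell D ^ 9 + Δ) := by
    rw [Real.exp_add, hlo_exp, hΔ, Real.exp_log hDt0]
  have hsub : S ⊆ S.filter (fun n : ℕ => (n : ℝ) ≤ lo * ((D : ℝ) * t0 D)) ∪
      S.filter (fun n : ℕ => Skeleton.P3 D / bigT D ≤ (n : ℝ)) := by
    intro n hn
    obtain ⟨hn1, hlon, hnhi, hwin⟩ := hS n hn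
    rw [Finset.mem_union, Finset.mem_filter, Finset.mem_filter]
    rcases hwin with h | h | h
    · exact Or.inr (And.intro hn h)
    · -- `y* ≤ P^{0.5}` ⇒ `n ≤ P^{0.496}·Dt₀`
      refine Or.inl (And.intro hn ?_)
      have e : yShift D (n : ℝ) = (n : ℝ) * bigP D ^ (0.004 : ℝ) / ((D : ℝ) * t0 D) := rfl
      rw [e, div_le_iff₀ hDt0] at h
      have h5 : bigP D ^ (0.5 : ℝ) = lo * bigP D ^ (0.004 : ℝ) := by
        rw [hlodef, ← Real.rpow_add hP0]; norm_num
      rw [h5, show lo * bigP D ^ (0.004 : ℝ) * ((D : ℝ) * t0 D) =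
        lo * ((D : ℝ) * t0 D) * bigP D ^ (0.004 : ℝ) by ring] at h
      exact le_of_mul_le_mul_right h (Real.rpow_pos_of_pos hP0 _)
    · -- `y* > P^{0.502}/T` ⇒ `n > P₃/T`
      refine Or.inr (And.intro hn ?_)
      have hyle : yShift D (n : ℝ) ≤ (n : ℝ) * bigP D ^ (0.004 : ℝ) := Lemma102.yShift_le hL1 (by positivity)
      have h1 : bigP D ^ (0.502 : ℝ) / bigT D < (n : ℝ) * bigP D ^ (0.004 : ℝ) := h.trans_le hyle
      have h5 : bigP D ^ (0.502 : ℝ) = Skeleton.P3 D * bigP D ^ (0.004 : ℝ) := by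
        rw [Skeleton.P3, ← Real.rpow_add hP0]; norm_num
      rw [h5, mul_div_right_comm] at h1
      exact le_of_lt (lt_of_mul_lt_mul_right h1 (Real.rpow_pos_of_pos hP0 _).le)
  have hA1 : 1 ≤ 0.496 * ell D ^ 9 := by nlinarith
  have h1 := weight_sum_Icc_exp 7 (A := 0.496 * ell D ^ 9) (B := 0.496 * ell D ^ 9 + Δ) hA1 (by linarith)
    (S.filter (fun n : ℕ => (n : ℝ) ≤ lo * ((D : ℝ) * t0 D)))
    (fun n hn => by
      rw [Finset.mem_filter] at hn
      obtain ⟨-, h2, -, -⟩ := hS n hn.1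
      have hle := hn.2
      rw [hlo_exp] at h2
      rw [hloDt_exp] at hle
      exact And.intro h2 hle)
  have hτsmall : τ ≤ 0.001 * ell D ^ 9 := by
    have h7 : (78125 : ℝ) ≤ ell D ^ 7 := by
      calc (78125 : ℝ) = 5 ^ 7 := by norm_num
        _ ≤ ell D ^ 7 := pow_le_pow_left₀ (by norm_num) hL5 7
    have h9 : ell D ^ 9 = ell D ^ 2 * ell D ^ 7 := by ring
    rw [h9]; nlinarith [pow_nonneg hL0.le 2]
  have h2 := weight_sum_Icc_exp 7 (A := 0.498 * ell D ^ 9 - τ) (B := 0.498 * ell D ^ 9)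
    (by linarith) (by linarith [hL1.trans hτℓ])
    (S.filter (fun n : ℕ => Skeleton.P3 D / bigT D ≤ (n : ℝ)))
    (fun n hn => by
      rw [Finset.mem_filter] at hn
      obtain ⟨-, -, h3, -⟩ := hS n hn.1
      have hge := hn.2
      rw [hP3T_exp] at hge
      rw [hhi_exp] at h3
      exact And.intro hge h3.le)
  have e256 : Real.exp (2 ^ (7 + 1)) = Real.exp 256 := by norm_num
  rw [e256] at h1 h2
  calc ∑ n ∈ S, ((n : ℝ) / Nat.totient n) ^ 7 / n
      ≤ ∑ n ∈ S.filter (fun n : ℕ => (n : ℝ) ≤ lo * ((D : ℝ) * t0 D)) ∪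
          S.filter (fun n : ℕ => Skeleton.P3 D / bigT D ≤ (n : ℝ)), ((n : ℝ) / Nat.totient n) ^ 7 / n :=
        Finset.sum_le_sum_of_subset_of_nonneg hsub fun n _ _ => by positivity
    _ ≤ ∑ n ∈ S.filter (fun n : ℕ => (n : ℝ) ≤ lo * ((D : ℝ) * t0 D)), ((n : ℝ) / Nat.totient n) ^ 7 / n +
        ∑ n ∈ S.filter (fun n : ℕ => Skeleton.P3 D / bigT D ≤ (n : ℝ)), ((n : ℝ) / Nat.totient n) ^ 7 / n := by
        rw [← Finset.sum_union_inter]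
        have : 0 ≤ ∑ n ∈ S.filter (fun n : ℕ => (n : ℝ) ≤ lo * ((D : ℝ) * t0 D)) ∩
            S.filter (fun n : ℕ => Skeleton.P3 D / bigT D ≤ (n : ℝ)), ((n : ℝ) / Nat.totient n) ^ 7 / n :=
          Finset.sum_nonneg fun n _ => by positivity
        linarith
    _ ≤ Real.exp 256 * (2 + (0.496 * ell D ^ 9 + Δ - 0.496 * ell D ^ 9)) +
        Real.exp 256 * (2 + (0.498 * ell D ^ 9 - (0.498 * ell D ^ 9 - τ))) := add_le_add h1 h2
    _ = Real.exp 256 * ((2 + Δ) + (2 + τ)) := by ring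
    _ ≤ Real.exp 256 * (525 * τ) := by
        refine mul_le_mul_of_nonneg_left ?_ (Real.exp_pos _).le
        linarith [hL1.trans hτℓ]
    _ = 525 * Real.exp 256 * τ := by ring

/-! ## The main theorem -/

set_option maxHeartbeats 1600000 in
/-- **`Z22:§10.u056 (i)` as a kernel EDGE** [Z22 p.61, tex L3089]: the typed display
`Typed.Sec10C.Mid1214Eval c′` — "the sum over `P^{0.496} ≤ dr < P^{0.498}` [of `S_j(𝐚₁₂,𝐚₁₄)`] is
equal to `(500L′(1,χ)²/log²P) Σ_{P^{0.496}≤n<P^{0.498}} |χ(n)|λ₀ⱼ(n)φ(n)⁻¹(ῑ₃𝔣_{j6}(P^{0.498}/n)/0.498 +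
ῑ₄𝔣_{j7}(P^{0.5}/n)/0.5)(−1 + 𝔶₁ⱼ(P^{0.004}n)) + o(α)`" — FOLLOWS from the shift-0 log-mean estimate
`Typed.Sec10Rel.LogMean0Rel c′` (the derivable relative content of "a result similar to Lemma 10.2"),
Lemma 8.2 (`Skeleton.Lemma82 c′`) and (8.10) (`Section8cStatements.Eq810`); the `T`-windows are handled
by the tree theorem `XiZeroMajorant.xiZeroTailMean`. Error `≤ K(c′)/(𝓛^{0.3}𝓛⁹) ≤ εα` for
`𝓛^{0.3} ≥ K/(επ)`. [cite: Zhang2022LandauSiegel, §10 p. 61] -/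
theorem mid1214Eval_of (hA : Sec10Rel.LogMean0Rel c') (h82 : Lemma82 c')
    (h810 : Section8cStatements.Eq810) : Mid1214Eval c' := by
  classical
  intro ε hε
  obtain ⟨C, HA⟩ := hA
  obtain ⟨C₂, H₂⟩ := h82
  obtain ⟨Cξ, Hξ⟩ := XiZeroMajorant.xiZeroTailMean c'
  -- the constants
  obtain ⟨cL, hcL⟩ : ∃ cL : ℝ, cL = 4 * Real.exp (9 / 2) := ⟨_, rfl⟩
  have hcL0 : 0 ≤ cL := by rw [hcL]; positivity
  obtain ⟨k₁, hk₁⟩ : ∃ k : ℝ, k = 0.003 * Real.exp 256 := ⟨_, rfl⟩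
  obtain ⟨k₂, hk₂⟩ : ∃ k : ℝ, k = 525 * Real.exp 256 := ⟨_, rfl⟩
  obtain ⟨k₃, hk₃⟩ : ∃ k : ℝ, k = 207 * cL := ⟨_, rfl⟩
  obtain ⟨k₄, hk₄⟩ : ∃ k : ℝ, k = 8.3 * |C₂| + 11500 * π * cL := ⟨_, rfl⟩
  obtain ⟨k₅, hk₅⟩ : ∃ k : ℝ, k = 1500 * |C| + 3550000 * π * cL := ⟨_, rfl⟩
  obtain ⟨k₆, hk₆⟩ : ∃ k : ℝ, k = 500 * cL := ⟨_, rfl⟩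
  obtain ⟨k₇, hk₇⟩ : ∃ k : ℝ, k = 240 * cL + 9 * |C₂| + 6 := ⟨_, rfl⟩
  obtain ⟨k₈, hk₈⟩ : ∃ k : ℝ, k = 2000 * (220 * cL + |C| + 16 * |Cξ|) := ⟨_, rfl⟩
  have hk₁0 : 0 ≤ k₁ := by rw [hk₁]; positivity
  have hk₂0 : 0 ≤ k₂ := by rw [hk₂]; positivity
  have hk₃0 : 0 ≤ k₃ := by rw [hk₃]; positivity
  have hk₄0 : 0 ≤ k₄ := by rw [hk₄]; positivity
  have hk₅0 : 0 ≤ k₅ := by rw [hk₅]; positivity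
  have hk₆0 : 0 ≤ k₆ := by rw [hk₆]; positivity
  have hk₇0 : 0 ≤ k₇ := by rw [hk₇]; positivity
  have hk₈0 : 0 ≤ k₈ := by rw [hk₈]; positivity
  obtain ⟨K, hK⟩ : ∃ K : ℝ, K = k₁ * (k₃ + k₄) * k₅ + 2 * k₁ * k₄ * k₆ + k₂ * k₇ * k₈ + 2 * k₂ * k₃ * k₆ :=
    ⟨_, rfl⟩
  have hK0 : 0 ≤ K := by rw [hK]; positivity
  obtain ⟨X, hX⟩ : ∃ X : ℝ, X = (K / (ε * π)) ^ ((10 : ℝ) / 3) := ⟨_, rfl⟩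
  have hX0 : 0 ≤ X := by rw [hX]; exact Real.rpow_nonneg (by positivity) _
  obtain ⟨D₀, hH⟩ := (HA.and H₂).and Hξ
  refine ⟨max D₀ (max ⌈Real.exp (π * |5 * c'| + 5)⌉₊ ⌈Real.exp X⌉₊), fun D _ χ hD hq hp hA' j hj => ?_⟩
  have hD₀ : D₀ ≤ D := le_trans (le_max_left _ _) hD
  have hDc : ⌈Real.exp (π * |5 * c'| + 5)⌉₊ ≤ D :=
    le_trans (le_trans (le_max_left _ _) (le_max_right _ _)) hD
  have hDX : ⌈Real.exp X⌉₊ ≤ D := le_trans (le_trans (le_max_right _ _) (le_max_right _ _)) hD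
  obtain ⟨hL5, hα, hc5'⟩ := large_D hDc
  have hc5 : 5 * |c'| * alpha D * ell D ≤ 1 := by
    have : |5 * c'| = 5 * |c'| := by rw [abs_mul, abs_of_pos (by norm_num : (0:ℝ) < 5)]
    rw [this] at hc5'; exact hc5'
  have hL0 : (0 : ℝ) < ell D := by linarith
  have hL1 : (1 : ℝ) ≤ ell D := by linarith
  have hℓ3 : 3 ≤ ell D := by linarith
  have hlog2 : 2 ≤ Real.log D := by have h := hL5; rw [ell] at h; linarith
  have hcαL : |c'| * alpha D * ell D ≤ 1 := by
    have h0 : 0 ≤ |c'| * alpha D * ell D := by positivity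
    linarith
  have hLX : X ≤ ell D := ell_ge_of_ceil_exp_le hDX
  obtain ⟨⟨HA', H₂'⟩, Hξ'⟩ := hH D χ hD₀ hq hp
  replace HA' := HA' hA' j hj
  replace H₂' := H₂' hA' j hj
  replace Hξ' := Hξ' j hj
  have hαeq : alpha D = π / ell D ^ 9 := by rw [alpha, bigP, Real.log_exp]
  have hlogP : Real.log (bigP D) = ell D ^ 9 := log_bigP D
  have hP0 : 0 < bigP D := Real.exp_pos _
  have hT0 : 0 < bigT D := Real.exp_pos _
  obtain ⟨h496_2, -, h498_5, h5_504, -, -, hNsupp⟩ := Ranges1422.range_facts (D := D) hℓ3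
  -- `σ = 𝓛^{0.1}`, `τ = 𝓛^{1.1} = ℓσ`
  obtain ⟨σ, hσdef⟩ : ∃ σ : ℝ, σ = ell D ^ (0.1 : ℝ) := ⟨_, rfl⟩
  obtain ⟨τ, hτdef⟩ : ∃ τ : ℝ, τ = ell D ^ (1.1 : ℝ) := ⟨_, rfl⟩
  have hσ1 : 1 ≤ σ := by rw [hσdef]; exact Real.one_le_rpow hL1 (by norm_num)
  have hσ10 : σ ^ 10 = ell D := by
    rw [hσdef, ← Real.rpow_natCast, ← Real.rpow_mul hL0.le]; norm_num
  have hτeq : τ = ell D * σ := by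
    rw [hτdef, hσdef, show (1.1 : ℝ) = 1 + 0.1 by norm_num, Real.rpow_add hL0, Real.rpow_one]
  have hσ3 : K / (ε * π) ≤ σ ^ 3 := by
    have h1 : (K / (ε * π)) = X ^ (0.3 : ℝ) := by
      rw [hX, ← Real.rpow_mul (by positivity)]; norm_num
    have h2 : X ^ (0.3 : ℝ) ≤ ell D ^ (0.3 : ℝ) := Real.rpow_le_rpow hX0 hLX (by norm_num)
    have h3 : ell D ^ (0.3 : ℝ) = σ ^ 3 := by
      rw [hσdef, ← Real.rpow_natCast, ← Real.rpow_mul hL0.le]; norm_num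
    rw [h1, ← h3]; exact h2
  ------------------------------------------------------------------
  -- the objects
  ------------------------------------------------------------------
  set lo : ℝ := bigP D ^ (0.496 : ℝ) with hlodef
  set hi : ℝ := bigP D ^ (0.498 : ℝ) with hhidef
  set S : Finset ℕ := (Finset.Ico 1 (Nsupp D)).filter (fun n : ℕ => lo ≤ (n : ℝ) ∧ (n : ℝ) < hi)
    with hSdef
  set M : ℕ → ℂ := fun n => Sec10C.mSum12 c' χ j n 1 with hMdef
  set M₀ : ℕ → ℂ := fun n => deriv χ.LFunction 1 *
      (conj iota3 * frakfW c' D j 6 (bigP D ^ (0.498 : ℝ) / n) / ((0.498 * Real.log (bigP D) : ℝ) : ℂ) +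
        conj iota4 * frakfW c' D j 7 (bigP D ^ (0.5 : ℝ) / n) / ((0.5 * Real.log (bigP D) : ℝ) : ℂ))
    with hM₀def
  set G : ℕ → ℂ := fun n => -1 + fraky1 c' D j (bigP D ^ (0.004 : ℝ) * n) with hGdef
  set c₀ : ℂ := 500 * deriv χ.LFunction 1 / (Real.log (bigP D) : ℂ) with hc₀def
  set a : ℕ → ℂ := fun n => (‖χ (n : ZMod D)‖ : ℂ) * lamZero c' D j n / (n : ℂ) with hadef
  set N : ℕ → ℕ → ℂ := fun d r => Sec10C.nSum14 c' χ j d r with hNdef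
  set main : ℕ → Prop := fun n => (n : ℝ) < Skeleton.P3 D / bigT D ∧
      bigP D ^ (0.5 : ℝ) < yShift D (n : ℝ) ∧ yShift D (n : ℝ) ≤ bigP D ^ (0.502 : ℝ) / bigT D
    with hmaindef
  set BM : ℝ := k₃ / ell D ^ 7 with hBMdef
  set eM : ℝ := k₄ * (ell D * σ) / ell D ^ 15 with heMdef
  set eN : ℝ := k₅ / ell D ^ 15 with heNdef
  set BW : ℝ := k₇ * (ell D * σ) ^ 2 / ell D ^ 9 with hBWdef
  set eW : ℝ := k₈ * ell D * (ell D * σ) ^ 4 / ell D ^ 9 with heWdef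
  have hBM0 : 0 ≤ BM := by positivity
  have heM0 : 0 ≤ eM := by positivity
  have heN0 : 0 ≤ eN := by positivity
  have hBW0 : 0 ≤ BW := by positivity
  have heW0 : 0 ≤ eW := by positivity
  have hmemS : ∀ {n : ℕ}, n ∈ S → 1 ≤ n ∧ lo ≤ (n : ℝ) ∧ (n : ℝ) < hi := fun hn => mem_midSet hn
  have hSne : ∀ n ∈ S, n ≠ 0 := fun n hn => by have := (hmemS hn).1; omega
  ------------------------------------------------------------------
  -- (A) re-indexing
  ------------------------------------------------------------------
  have hreidx : S1214On c' χ j lo hi =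
      ∑ n ∈ S, ∑ r ∈ n.divisors,
        (if Squarefree r then a n / (Nat.totient r : ℂ) * M n * N (n / r) r else 0) := by
    rw [S1214On_eq_divisor_sum c' χ j (fun n hn => hNsupp n (by linarith))]
    refine Finset.sum_congr rfl fun n hn => Finset.sum_congr rfl fun r hr => ?_
    obtain ⟨hn1, -, -⟩ := hmemS hn
    have hr0 : 0 < r := Nat.pos_of_mem_divisors hr
    have hrn : r ∣ n := (Nat.mem_divisors.mp hr).1
    have hnr : n / r * r = n := Nat.div_mul_cancel hrn
    have hd1 : 1 ≤ n / r := Nat.div_pos (Nat.le_of_dvd (by omega) hrn) hr0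
    split_ifs with hsq
    · have hMn : Sec10C.mSum12 c' χ j (n / r) r = M n := by
        rw [hMdef]; simp only
        rw [mSum12_eq c' χ hlog2 j hd1 hr0, mSum12_eq c' χ hlog2 j hn1 le_rfl, hnr, Nat.mul_one]
      rw [hMn]
    · rfl
  ------------------------------------------------------------------
  -- (B) the hypotheses of the assembly
  ------------------------------------------------------------------
  have hM : ∀ n ∈ S, main n → ‖M n - M₀ n‖ ≤ eM := by
    intro n hn hmain
    obtain ⟨hn1, hlon, hnhi⟩ := hmemS hn
    have hmain' : (n : ℝ) < Skeleton.P3 D / bigT D := by rw [hmaindef] at hmain; exact hmain.1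
    have h := mid_M_main_le c' χ hL5 hc5 hp j H₂' hn1 hlon hnhi hmain'
    refine h.trans (le_of_eq ?_)
    rw [heMdef, hk₄, hcL, hτeq.symm.trans hτdef]
  have hM₀ : ∀ n ∈ S, ‖M₀ n‖ ≤ BM := by
    intro n hn
    obtain ⟨hn1, hlon, hnhi⟩ := hmemS hn
    have h := mid_M0_le c' χ hL5 hc5 hp j hn1 hlon hnhi
    refine h.trans (le_of_eq ?_)
    rw [hBMdef, hk₃, hcL]
  have hMW : ∀ n ∈ S, ¬ main n → ‖M n‖ ≤ BW := by
    intro n hn _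
    obtain ⟨hn1, hlon, hnhi⟩ := hmemS hn
    have h := mid_M_crude_le c' χ hL5 hc5 hp j H₂' hn1 hlon hnhi
    refine h.trans (le_of_eq ?_)
    rw [hBWdef, hk₇, hcL, hτeq.symm.trans hτdef]
  have hG : ∀ n ∈ S, ‖G n‖ ≤ 2 := by
    intro n hn
    obtain ⟨hn1, hlon, hnhi⟩ := hmemS hn
    exact mid_G_le c' hL5 hcαL j hn1 hlon hnhi
  have hN : ∀ n ∈ S, main n → ∀ r ∈ n.divisors, Squarefree r →
      ‖N (n / r) r - c₀ * PiW χ (n / r) r * G n‖ ≤ eN * ((n : ℝ) / Nat.totient n) ^ 2 := by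
    intro n hn hmain r hr _
    obtain ⟨hn1, hlon, hnhi⟩ := hmemS hn
    have hm : bigP D ^ (0.5 : ℝ) < yShift D (n : ℝ) ∧ yShift D (n : ℝ) ≤ bigP D ^ (0.502 : ℝ) / bigT D := by
      rw [hmaindef] at hmain; exact hmain.2
    have h := mid_N_main_le c' χ hL5 hcαL hp j HA' hn1 hlon hnhi hr hm.1 hm.2
    have e : N (n / r) r - c₀ * PiW χ (n / r) r * G n = Sec10C.nSum14 c' χ j (n / r) r -
        500 * deriv χ.LFunction 1 / (Real.log (bigP D) : ℂ) * PiW χ (n / r) r *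
          (-1 + fraky1 c' D j (bigP D ^ (0.004 : ℝ) * n)) := by
      rw [hNdef, hc₀def, hGdef]
    rw [e]
    refine h.trans (le_of_eq ?_)
    rw [heNdef, hk₅, hcL]
  have hW : ∀ n ∈ S, ¬ main n → ∀ r ∈ n.divisors, Squarefree r →
      ‖N (n / r) r‖ ≤ eW * ((n : ℝ) / Nat.totient n) ^ 2 := by
    intro n hn _ r hr _
    obtain ⟨hn1, hlon, hnhi⟩ := hmemS hn
    have h := mid_N_window_le c' χ hL5 hcαL hp j HA' Hξ' hn1 hlon hnhi hr
    refine h.trans (le_of_eq ?_)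
    rw [heWdef, hk₈, hcL, hτeq.symm.trans hτdef]
  have hPi : ∀ n ∈ S, main n →
      ∑ r ∈ n.divisors with Squarefree r, (1 / (Nat.totient r : ℂ)) * PiW χ (n / r) r =
        (n : ℂ) / (Nat.totient n : ℂ) := fun n hn _ => h810 D χ hq n (hSne n hn)
  ------------------------------------------------------------------
  -- (C) the abstract assembly
  ------------------------------------------------------------------
  have hRA := Ranges1422.range_assembly_bound₃ hSne main a M M₀ G N (PiW χ) c₀ heM0 hBM0 hBW0 hPi hM hM₀
    hMW hG hN hW
  ------------------------------------------------------------------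
  -- (D) main term and weights
  ------------------------------------------------------------------
  have hMT : ∑ n ∈ S, a n * ((n : ℂ) / (Nat.totient n : ℂ)) * (M₀ n * c₀ * G n) = midSum1214 c' χ j := by
    rw [hSdef, hlodef, hhidef, Ranges1422.midSet_eq hℓ3]
    unfold midSum1214 lamAvg
    rw [Finset.mul_sum]
    refine Finset.sum_congr rfl fun n hn => ?_
    have hn1 : 1 ≤ n := by
      have := (Finset.mem_Ico.mp hn).1
      have : (2 : ℝ) ≤ ⌈bigP D ^ (0.496 : ℝ)⌉₊ := h496_2.trans (Nat.le_ceil _)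
      have : 2 ≤ ⌈bigP D ^ (0.496 : ℝ)⌉₊ := by exact_mod_cast this
      omega
    have hn0 : (n : ℂ) ≠ 0 := by exact_mod_cast (by omega : n ≠ 0)
    have hΛ0 : (Real.log (bigP D) : ℂ) ≠ 0 := by
      rw [hlogP]; exact_mod_cast (pow_pos hL0 9).ne'
    have hφ0 : (Nat.totient n : ℂ) ≠ 0 := by exact_mod_cast (Nat.totient_pos.mpr (by omega)).ne'
    rw [hadef, hM₀def, hGdef, hc₀def]
    simp only
    push_cast
    field_simp
  have hweight : ∀ n ∈ S, ‖a n‖ * ((n : ℝ) / Nat.totient n) ^ 3 ≤ ((n : ℝ) / Nat.totient n) ^ 7 / n := by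
    intro n hn
    have hn0 := hSne n hn
    have hχ : ‖χ (n : ZMod D)‖ ≤ 1 := DirichletCharacter.norm_le_one χ _
    have hlam := norm_lamZero_le c' D j hn0
    rw [hadef]
    simp only
    rw [norm_div, norm_mul, Complex.norm_real, Real.norm_eq_abs, abs_norm, Complex.norm_natCast]
    calc ‖χ (n : ZMod D)‖ * ‖lamZero c' D j n‖ / n * ((n : ℝ) / Nat.totient n) ^ 3
        ≤ 1 * ((n : ℝ) / Nat.totient n) ^ 4 / n * ((n : ℝ) / Nat.totient n) ^ 3 := by gcongr
      _ = ((n : ℝ) / Nat.totient n) ^ 7 / n := by ring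
  have hWm : ∑ n ∈ S.filter main, ‖a n‖ * ((n : ℝ) / Nat.totient n) ^ 3 ≤ k₁ * ell D ^ 9 := by
    have hw := mid_weight_main_le (D := D) hL5 (S.filter main) (fun n hn => hmemS (Finset.mem_of_mem_filter n hn))
    rw [hk₁]
    exact le_trans (Finset.sum_le_sum fun n hn => hweight n (Finset.mem_of_mem_filter n hn)) hw
  have hWw : ∑ n ∈ S.filter (fun n => ¬ main n), ‖a n‖ * ((n : ℝ) / Nat.totient n) ^ 3 ≤
      k₂ * (ell D * σ) := by
    have hw := mid_weight_window_le (D := D) hL5 (S.filter (fun n => ¬ main n)) (fun n hn => by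
      rw [Finset.mem_filter] at hn
      obtain ⟨h1, h2, h3⟩ := hmemS hn.1
      have hnm := hn.2
      rw [hmaindef] at hnm
      simp only [not_and_or, not_lt, not_le] at hnm
      exact ⟨h1, h2, h3, hnm⟩)
    rw [hk₂, ← hτeq, hτdef]
    exact le_trans (Finset.sum_le_sum fun n hn => hweight n (Finset.mem_of_mem_filter n hn)) hw
  ------------------------------------------------------------------
  -- (E) conclusion
  ------------------------------------------------------------------
  rw [hreidx, ← hMT]
  refine hRA.trans ?_
  have hc₀n : ‖c₀‖ ≤ k₆ / ell D ^ 7 := by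
    rw [hc₀def, hk₆, norm_div, norm_mul, Complex.norm_real, hlogP, Real.norm_of_nonneg (by positivity)]
    have h500 : ‖(500 : ℂ)‖ = 500 := by norm_num
    have hLp : ‖deriv χ.LFunction 1‖ ≤ cL * ell D ^ 2 := by
      rw [hcL]; exact norm_deriv_LFunction_one_le χ hℓ3 hp
    rw [h500, show 500 * cL / ell D ^ 7 = 500 * (cL * ell D ^ 2) / ell D ^ 9 by field_simp]
    gcongr
  have step : (∑ n ∈ S.filter main, ‖a n‖ * ((n : ℝ) / Nat.totient n) ^ 3) *
        ((BM + eM) * eN + eM * ‖c₀‖ * 2) +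
      (∑ n ∈ S.filter (fun n => ¬ main n), ‖a n‖ * ((n : ℝ) / Nat.totient n) ^ 3) *
        (BW * eW + BM * ‖c₀‖ * 2) ≤
      (∑ n ∈ S.filter main, ‖a n‖ * ((n : ℝ) / Nat.totient n) ^ 3) *
        ((BM + eM) * eN + eM * (k₆ / ell D ^ 7) * 2) +
      (∑ n ∈ S.filter (fun n => ¬ main n), ‖a n‖ * ((n : ℝ) / Nat.totient n) ^ 3) *
        (BW * eW + BM * (k₆ / ell D ^ 7) * 2) := by
    have hWm0 : 0 ≤ ∑ n ∈ S.filter main, ‖a n‖ * ((n : ℝ) / Nat.totient n) ^ 3 :=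
      Finset.sum_nonneg fun n _ => by positivity
    have hWw0 : 0 ≤ ∑ n ∈ S.filter (fun n => ¬ main n), ‖a n‖ * ((n : ℝ) / Nat.totient n) ^ 3 :=
      Finset.sum_nonneg fun n _ => by positivity
    gcongr
  refine step.trans ?_
  rw [hαeq]
  exact mid_numeric hL1 hσ1 hσ10 hε hk₁0 hk₂0 hk₃0 hk₄0 hk₅0 hk₆0 hk₇0 hBM0 heM0 heN0 (by positivity)
    hBW0 heW0 hWm hWw le_rfl le_rfl le_rfl le_rfl le_rfl le_rfl (by rw [hK] at hσ3; exact hσ3)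

/-- **`Z22:§10.u056 (i)` HOLDS** (`c′ ≥ 0`): `Typed.Sec10C.Mid1214Eval c′`, all three inputs of
`mid1214Eval_of` being tree theorems — the shift-0 log-mean estimate
(`Lemma102.logMeanRel_of_lemma83Rel (Skeleton.lemma83Rel_holds c′)`), Lemma 8.2
(`Skeleton.lemma82_holds`, needs `0 ≤ c′`) and (8.10) (`Section8FrontEnd810.eq810_holds`).
[cite: Zhang2022LandauSiegel, §10 p. 61] -/
theorem mid1214Eval_holds (hc : 0 ≤ c') : Mid1214Eval c' :=
  mid1214Eval_of c' (Lemma102.logMeanRel_of_lemma83Rel (lemma83Rel_holds c')) (lemma82_holds hc)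
    Section8FrontEnd810.eq810_holds

end W10Mid1214Eval

end Literature.NumberTheory.LFunctions.Zhang2022.Typed.Sec10C
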